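import Summits.BirchSwinnertonDyer.BirchSwinnertonDyer.Theorems.TwoAdicConverseOrdLambdaHalfAtTwoBDPTwoVariableDefs
import Summits.BirchSwinnertonDyer.BirchSwinnertonDyer.Theorems.TwoAdicConverseBDPSelmerLowerDivisibilityAtTwoGaussContent
import Summits.BirchSwinnertonDyer.BirchSwinnertonDyer.Theorems.TwoAdicConverseBDPSelmerLowerDivisibilityAtTwoCharIdealPrincipal
import Literature.NumberTheory.EllipticCurves.ZpExtensionSplitPrimeLineThroughPair
import Literature.NumberTheory.EllipticCurves.ZpExtensionPairTowerUniversalProofs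
import Literature.NumberTheory.IwasawaTheory.IwasawaAlgebraTwoVar
import Mathlib.RingTheory.MvPowerSeries.Substitution
import Mathlib.RingTheory.PowerSeries.Binomial
import Literature.NumberTheory.EllipticCurves.IwasawaCyclotomicProofs
import HarnessLib

/-!
# `cyclotomic_prime_pinning_two` — crux-idea NODE for O2 `BDPSelmerLowerDivisibilityAtTwo` (stmt-BirchSwinnertonDyer-24728),
# seat 2, round 1, GEN 9 (2026-08-30): ACPIN's «∃ prime 𝔓 of the special fibre» PINNED AT THE CONSUMER'S PRIME — the residual
# prime `𝔓_cyc` of the CYCLOTOMIC `ℤ₂`-line — so that ONE pair of leaves (N_cyc, Λ_cyc) closes v7's ACPIN (⟹ O2, with U) AND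
# seat 1's U-free cyclotomic shadow O2′ (⟹ the consumer 6‴ WITHOUT U)

Lens (declared on HOME/STATUS): `strengthen`@stub(R0G ↦ RIP) × pin@𝔓_cyc.  The statement of the line of record (v7/v8) has the
research stubs U (two-variable rational upper inclusion — walled at `2`: Beilinson–Flach classes O-c and their explicit reciprocity
law O-d are in print for `p ≥ 3` only, CENSUS-r1-1-g6), R0G, P3, ACPIN.  Every ACPIN witness filed so far (seat 1 GEN 8: `𝔓_ac`;
this seat GEN 8: `𝔓ᵥ`) reaches the consumer 6‴ = `ThetaShapiroGreenbergDivisibilityAtTwo` only THROUGH U (one pinned fibre + U +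
Gauss rigidity ⟹ two-variable equality ⟹ the cyclotomic `λ`-inequality 6‴ consumes).  Seat 1 GEN 7 (`cyclotomic_shadow_two`)
showed the consumer needs only the cyclotomic `λ`-shadow O2′ and proposed O2′ ⟸ R0T ∧ Rres ∧ N with Rres's analytic leaf R_an a
TWO-VARIABLE MEASURE-LEVEL congruence at `2` (unprinted at any `p` off the anticyclotomic line).  THIS NODE pins at `𝔓_cyc`
itself: `𝔓_cyc := ker (redLineRes J (κγ₁) (κγ₂))` for the cyclotomic `ℤ₂`-extension `κ` (it EXISTS in every frame — tree
`ZpExtension.exists_isCyclotomic_holds` — and its covector through any presented pair is PRIMITIVE, `isUnit_or_isUnit_of_line`),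
and the SAME two leaves
  N_cyc (`CycLineMuZeroAtTwo`):  `red(G|_cyc) ≠ 0` in every frame            (`μ` of the cyclotomic shadow of `G` vanishes),
  Λ_cyc (`CycLineLambdaAtTwo`):  `red(G|_cyc) ∣ red(C₁|_cyc)` in `𝔽̄₂⟦T⟧`   (`λ_cyc(G) ≤ λ_cyc(C₁)`, Eisenstein direction)
serve BOTH architectures:
  (i)  N_cyc ∧ Λ_cyc ∧ L1 ⟹[`acFibrePinningAtTwo_of_cycLine`, sorry-free] ACPIN (v7's registered `stub_acFibrePinning` VERBATIM), and
       O2 ⟸[`bdpSelmerLowerDivisibilityAtTwo_of_cycLine`, sorry-free] P0 ∧ CONTENT ∧ U ∧ R0T ∧ N_cyc ∧ Λ_cyc (g3's Gauss pin on the line);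
  (ii) N_cyc ∧ Λ_cyc ∧ N_alg ∧ R0T ∧ L2 ⟹[`cycShadowLowerAtTwo_of_cycLine`, sorry-free] O2′ = seat 1's `CycShadowLowerAtTwo` VERBATIM,
       hence O1′ ∧ R0T ∧ N_alg ∧ N_cyc ∧ Λ_cyc ∧ L2 ⟹[`thetaShapiroGreenbergDivisibilityAtTwo_of_cycLine`, sorry-free] 6‴ — NO U, NO Rres.
So U is OFF the critical path of crux 19556 while the registered skeleton v7/v8 is untouched (if U lands, (i) gives O2 as typed;
if U never lands, (ii) still delivers the unique consumer).  `𝔓_cyc` is the only prime with this property.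

WHY `𝔓_cyc` IS READABLE although the cyclotomic line is a SHADOW for both `G` and the Katz measure (no interpolation there — the
reason every earlier node avoided it).  (a) Residual translation invariance (this seat GEN 8, kernel `redLineRes_red₂`/`map_lineSubst`):
characters of the pro-2 group `Γ_K` are `≡ 1 mod 𝔪`, so EVERY translate of the cyclotomic line by a character has residual prime
`𝔓_cyc`; (b) NEW: the translate of the cyclotomic line through an UNRAMIFIED `ξ` of infinity type `(−(m+1), n+1)` (a point of the
typed cone of `IsGreenbergLFunctionFree₂`) contains the DEEP arithmetic points `ξ·(χ∘N_{K/ℚ})`, `χ` a Dirichlet character of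
`2`-power order and conductor: SAME infinity type (so inside the cone for every `χ`), ramified only above `2`, and `v₂(χ(γ_cyc) − 1) → 0`
— exactly the regime of the deep-point lemma DP (`DeepPointResidual₁`, kernel): `v₂(F|_ℓ(ζ_{2^k} − 1)) = λ(F|_ℓ)·v₂(ζ_{2^k} − 1)` for
`k ≫ 0` when `μ(F|_ℓ) = 0`.  The values there are cyclotomic `2`-power twists of ONE Rankin–Selberg `L`-function
`L(f × θ_ξ ⊗ χ, s₀)` (a CM form `θ_ξ` of weight `m+n+3 ≥ 3`, `θ`-dominant: CM periods on both sides), against the Katz values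
`L(ξχ∘N, 0)·L(ξ'χ∘N, 0)` of the Eisenstein model (`f ≡ E′ mod 2` on habitat (β)).  (c) The typed frame `IsGreenbergLFunctionFree₂`
pins `G` at UNRAMIFIED `ξ` only — all SHALLOW points (`v₂(ξ̂(γᵢ) − 1) ≥ 1`), and value congruences at shallow points can NOT pin
residual orders (toy: `F = T` and `F = 0` agree mod `4` at every point of `|T| ≤ |4|`, yet `red T ≠ 0` — the CENSUS-r1-1-g6 §3
phenomenon `2/T₁`).  Hence the lens: STRENGTHEN R0G's frame to RIP = «`G` also interpolates, with the standard Gauss-sum factor, at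
the ramified twists `ξ·χ∘N` on ONE cone-interior translate» (every measure-valued construction of `𝓛^Gr` gives this; BDP Thm 5.9 /
Castella–Hsieh 2018 Thm 4.6 shape, `p` odd in print).  Second-layer leaves of N_cyc / Λ_cyc (informal, tagged in the card):
  RIP (research, R0G⁺-class) · VC (research, Kriz-2016-type VALUE-level congruence `G(ξχ) ≡ u·LK(ξ₁χ)LK(ξ₂χ)·∏Euler mod 2^c`, fixed
  depth `c`, at the deep twists of ONE translate; INSTRUMENTABLE: `v₂`-slopes of `L^{alg}(f × θ_ξ ⊗ χ)` vs `v₂(ζ_{2^k}−1)` on 1289a1,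
  1913b1 / `K = ℚ(√−7)`) · DP (kernel) · N^{Katz}_cyc (`red LK ∉ 𝔓_cyc`: Ferrero–Washington at `p = 2` for the abelian field `K·ℚ_∞`
  + reflection + the GL(1) main conjecture for `K` at `2` under `μ = 0`, JLK 2011 Thm 5.2 / OV16 — PRINT-ATTACKABLE) · ALG_cyc (= v7's
  R_alg ∧ R_KMC restricted to `𝔓_cyc`: two-variable residual dévissage is EXACT in height one, the one-variable cyclotomic count is
  not — lead v5 VERDICT; shared with v7/seat 1, not new).
§0–§4, §5b, §5c are VERBATIM this seat's GEN 8 `Lines/split_prime_edge_pinning_two.lean` (itself §0–§4 = GEN 3 annex); §5 (cyclotomic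
pieces and seams), §6 (stubs + composition BY NAME) and §7 (seat 1's shadow decls VERBATIM + the U-free seams) are new.
NOT registered (`ledger skeleton check` slot of record = v7/v8 `two_variable_gv_squeeze_two`); no stub of another seat touched.
HONESTY: nothing here is proved about any curve; BSD is proved for no curve; O2, U, R0T/R0G, N_cyc, Λ_cyc, RIP, VC, O1′ stay OPEN;
typed ≠ proved; the sorry-free seams are logic + commutative algebra over the pieces.
-/

set_option linter.dupNamespace false
set_option autoImplicit false

noncomputable section

open scoped Classical NumberField
open WeierstrassCurve NumberField IsDedekindDomain Field CategoryTheory Function CongruenceSubgroup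
open Literature.NumberTheory.EllipticCurves Literature.NumberTheory.EllipticCurves.Rank1Residual
open Literature.NumberTheory.EllipticCurves.ModularForms
open Literature.NumberTheory.GaloisRepresentations
open Literature.NumberTheory.EllipticCurves.IwasawaAlgebra₂ Literature.NumberTheory.EllipticCurves.UnrSeries₂
open Literature.NumberTheory.EllipticCurves.YanZhu2026
open Literature.NumberTheory.IwasawaTheory
open Summit.BirchSwinnertonDyer.BirchSwinnertonDyer.Theorems.TwoAdicKatoDeterminant
open Summit.BirchSwinnertonDyer.BirchSwinnertonDyer.Theorems.TwoAdicBDPGaussContent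


namespace Summit.BirchSwinnertonDyer.BirchSwinnertonDyer.Cruxes.BDPSelmerLowerDivisibilityAtTwo.CyclotomicPrimePinningTwo

/-! ## §0 Shared pieces of the line of record `two_variable_gv_squeeze_two` (v3), re-declared character for character -/

/-- `𝒪_{ℂ₂}⟦T₁,T₂⟧` (outer `T₁ ↔ γ₁`, inner `T₂ ↔ γ₂`). [= `TwoVariableGvSqueezeTwo.A₂`] -/
abbrev A₂ : Type := PowerSeries (PowerSeries (PadicComplexInt 2))

/-- `𝔽̄₂⟦T₁,T₂⟧`. [= `TwoVariableGvSqueezeTwo.Ω₂`] -/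
abbrev Ω₂ : Type := PowerSeries (PowerSeries (IsLocalRing.ResidueField (PadicComplexInt 2)))

/-- Coefficientwise reduction `𝒪_{ℂ₂}⟦T₁,T₂⟧ → 𝔽̄₂⟦T₁,T₂⟧`. [= `TwoVariableGvSqueezeTwo.red₂`] -/
def red₂ : A₂ →+* Ω₂ := PowerSeries.map (PowerSeries.map (IsLocalRing.residue (PadicComplexInt 2)))

/-- **U at `(E,K)`** [= `TwoVariableGvSqueezeTwo.GreenbergUpperInclusionRatAt`, verbatim]: the Euler-system-directional
(UPPER) inclusion at `2` with `2`-power slack, for EVERY admissible frame datum. -/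
def GreenbergUpperInclusionRatAt (W : WeierstrassCurve ℚ) [W.IsElliptic] [W.IsGloballyMinimal]
    (K : Type) [Field K] [NumberField K] : Prop :=
  ∀ [IsCMField K] (ι : PadicAlgCl 2 ≃+* ℂ) (v vbar : HeightOneSpectrum (𝓞 K)) (κ₁ κ₂ : ZpExtension K 2)
    (γ₁ γ₂ : absoluteGaloisGroup K) [Fact (ZpExtension.IsTopGeneratorPair κ₁ κ₂ γ₁ γ₂)]
    [NeZero (W.conductorNorm ℤ)] (f : CuspForm (Gamma0 (W.conductorNorm ℤ)) 2),
    ModularForms.IsNewformOf W f → ∀ [NeZero (NumberField.discr K).natAbs],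
    ((2 : ℕ) : 𝓞 K) ∈ v.asIdeal → ((2 : ℕ) : 𝓞 K) ∈ vbar.asIdeal → vbar ≠ v →
    (∀ (w : InfinitePlace K) (k : 𝓞 K), k ∈ v.asIdeal ↔ ‖ι.symm (w.embedding (k : K))‖ < 1) →
    ∀ (Ω δ : ℂ) (Ωp : (unrIntegers 2)ˣ) (LK G : A₂),
      Ω ≠ 0 → (δ ^ 2 = (NumberField.discr K : ℂ) ∨ δ ^ 2 = -(NumberField.discr K : ℂ)) →
      IsKatzMeasure₂ ι v vbar ∅ κ₁ κ₂ γ₁⁻¹ γ₂⁻¹ 1 Ω δ ((Ωp : unrIntegers 2) : ℂ_[2]) LK →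
      IsGreenbergLFunctionFree₂ ι v vbar κ₁ κ₂ γ₁⁻¹ γ₂⁻¹ f (NumberField.discr K).natAbs
        (NumberField.classNumber K) LK G →
      ∀ J : ℤ_[2] →+* PadicComplexInt 2,
        (∀ x : ℤ_[2], ((J x : PadicComplexInt 2) : ℂ_[2]) = ((x : ℚ_[2]) : ℂ_[2])) →
        ∃ m : ℕ, Ideal.span {(2 : A₂) ^ m * G} ≤
          (WeierstrassCurve.XGr₂.charIdeal (W.baseChange K) 2 κ₁ κ₂ vbar γ₁ γ₂).map (toUnr₂ 2 J)

/-- **P0 at `(E,K)`** [= `TwoVariableGvSqueezeTwo.XGr₂CharIdealPrincipalAt`, verbatim]: principality of the two-variable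
characteristic ideal of a torsion `X_Gr(E/K̃_∞)` (kernel algebra, proved: p766476). -/
def XGr₂CharIdealPrincipalAt (W : WeierstrassCurve ℚ) [W.IsElliptic] [W.IsGloballyMinimal]
    (K : Type) [Field K] [NumberField K] : Prop :=
  ∀ (vbar : HeightOneSpectrum (𝓞 K)) (κ₁ κ₂ : ZpExtension K 2) (γ₁ γ₂ : absoluteGaloisGroup K)
    [Fact (ZpExtension.IsTopGeneratorPair κ₁ κ₂ γ₁ γ₂)],
    Module.IsTorsion (IwasawaAlgebra₂ 2) ((W.baseChange K).XGr₂ 2 κ₁ κ₂ vbar γ₁ γ₂) →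
    ∃ C : IwasawaAlgebra₂ 2, WeierstrassCurve.XGr₂.charIdeal (W.baseChange K) 2 κ₁ κ₂ vbar γ₁ γ₂ = Ideal.span {C}

/-- **R0T at `(E,K)`** [= `TwoVariableGvSqueezeTwo.GreenbergFrameTorsionAt`, verbatim]: an admissible frame datum exists at
`2` and `X_Gr(E/K̃_∞)` is `Λ_K`-torsion (the OBJECT half of R). -/
def GreenbergFrameTorsionAt (W : WeierstrassCurve ℚ) [W.IsElliptic] [W.IsGloballyMinimal]
    (K : Type) [Field K] [NumberField K] : Prop :=
  ∀ [IsCMField K] (ι : PadicAlgCl 2 ≃+* ℂ) (v vbar : HeightOneSpectrum (𝓞 K)) (κ₁ κ₂ : ZpExtension K 2)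
    (γ₁ γ₂ : absoluteGaloisGroup K) [Fact (ZpExtension.IsTopGeneratorPair κ₁ κ₂ γ₁ γ₂)]
    [NeZero (W.conductorNorm ℤ)] (f : CuspForm (Gamma0 (W.conductorNorm ℤ)) 2),
    ModularForms.IsNewformOf W f → ∀ [NeZero (NumberField.discr K).natAbs],
    ((2 : ℕ) : 𝓞 K) ∈ v.asIdeal → ((2 : ℕ) : 𝓞 K) ∈ vbar.asIdeal → vbar ≠ v →
    (∀ (w : InfinitePlace K) (k : 𝓞 K), k ∈ v.asIdeal ↔ ‖ι.symm (w.embedding (k : K))‖ < 1) →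
    ∃ (Ω δ : ℂ) (Ωp : (unrIntegers 2)ˣ) (LK G : A₂),
      Ω ≠ 0 ∧ (δ ^ 2 = (NumberField.discr K : ℂ) ∨ δ ^ 2 = -(NumberField.discr K : ℂ)) ∧
      IsKatzMeasure₂ ι v vbar ∅ κ₁ κ₂ γ₁⁻¹ γ₂⁻¹ 1 Ω δ ((Ωp : unrIntegers 2) : ℂ_[2]) LK ∧
      IsGreenbergLFunctionFree₂ ι v vbar κ₁ κ₂ γ₁⁻¹ γ₂⁻¹ f (NumberField.discr K).natAbs
        (NumberField.classNumber K) LK G ∧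
      Module.IsTorsion (IwasawaAlgebra₂ 2) ((W.baseChange K).XGr₂ 2 κ₁ κ₂ vbar γ₁ γ₂)

/-- U on the habitat (β) [= `TwoVariableGvSqueezeTwo.TwoVariableUpperInclusionRatAtTwo`]. Research grade, shared. -/
def TwoVariableUpperInclusionRatAtTwo : Prop :=
  ∀ (W : WeierstrassCurve ℚ) [W.IsElliptic] [W.IsGloballyMinimal],
    ¬ W.HasCM → GoodOrd W 2 → ¬ W.HasIrreducibleModPGaloisRep 2 →
    ∀ (K : Type) [Field K] [NumberField K],
      (IsImaginaryQuadratic K ∧ SatisfiesHeegnerHypothesis (2 * W.conductorNorm ℤ) K) →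
      GreenbergUpperInclusionRatAt W K

/-- P0 on the habitat [= `TwoVariableGvSqueezeTwo.XGr₂CharIdealPrincipalAtTwo`]. Kernel algebra. -/
def XGr₂CharIdealPrincipalAtTwo : Prop :=
  ∀ (W : WeierstrassCurve ℚ) [W.IsElliptic] [W.IsGloballyMinimal] (K : Type) [Field K] [NumberField K],
    XGr₂CharIdealPrincipalAt W K

/-- R0T on the habitat (β) [= `TwoVariableGvSqueezeTwo.TwoVariableFrameTorsionAtTwo`]. Research grade, shared. -/
def TwoVariableFrameTorsionAtTwo : Prop :=
  ∀ (W : WeierstrassCurve ℚ) [W.IsElliptic] [W.IsGloballyMinimal],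
    ¬ W.HasCM → GoodOrd W 2 → ¬ W.HasIrreducibleModPGaloisRep 2 →
    ∀ (K : Type) [Field K] [NumberField K],
      (IsImaginaryQuadratic K ∧ SatisfiesHeegnerHypothesis (2 * W.conductorNorm ℤ) K) →
      GreenbergFrameTorsionAt W K

/-- **CONTENT** [= seat 1's `AnticyclotomicFibrePinningTwo.TwoContent₂`, verbatim statement]: every non-zero `C₀ ∈ Λ_K = ℤ₂⟦T₁,T₂⟧`
reads along any `J : ℤ₂ → 𝒪_{ℂ₂}` as `J C₀ = 2^a · C₁` with `C₁` PRIMITIVE (`red₂ C₁ ≠ 0`); positive algebraic `μ` is allowed. -/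
def TwoContent₂ : Prop :=
  ∀ (J : ℤ_[2] →+* PadicComplexInt 2) (C₀ : IwasawaAlgebra₂ 2), C₀ ≠ 0 →
    ∃ (a : ℕ) (C₁ : A₂), toUnr₂ 2 J C₀ = (2 : A₂) ^ a * C₁ ∧ red₂ C₁ ≠ 0

/-- `2^a = C(C(2^a))` in `𝒪_{ℂ₂}⟦T₁,T₂⟧` (from p766427 `natCast_pow_eq_C_C`). -/
theorem two_pow_eq_C_C (a : ℕ) :
    (2 : A₂) ^ a = PowerSeries.C (PowerSeries.C ((2 : PadicComplexInt 2) ^ a)) := by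
  have h := natCast_pow_eq_C_C (p := 2) a
  simpa only [Nat.cast_ofNat] using h

section Content
open PowerSeries in
/-- **CONTENT holds** (kernel).  PROOF = seat 1's `twoContent₂_holds` (`Lines/anticyclotomic_fibre_pinning_two.lean` §2,
planner-cruxidea-stmt-BirchSwinnertonDyer-24728-1 GEN 3), copied with attribution because Cruxes files are not importable
(the lead's `TwoAdicBDPPrimePinning.exists_toUnr₂_eq_two_pow_mul_of_ne_zero` is the same port to `Theorems/`). [folklore] -/
theorem twoContent₂_holds : TwoContent₂ := by
  intro J C₀ hC₀
  have hcoef : ∃ ij : ℕ × ℕ, coeff ij.2 (coeff ij.1 C₀) ≠ 0 := by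
    by_contra hall
    push Not at hall
    exact hC₀ (PowerSeries.ext fun i => PowerSeries.ext fun j => by simpa using hall (i, j))
  obtain ⟨ij₀, hij₀⟩ := hcoef
  have hirr : Irreducible (2 : ℤ_[2]) := by
    have h := PadicInt.irreducible_p (p := 2)
    rwa [Nat.cast_ofNat] at h
  obtain ⟨n₀, c, hc, hn₀⟩ := WfDvdMonoid.max_power_factor hij₀ hirr
  have hex : ∃ n : ℕ, ∃ ij : ℕ × ℕ, ¬ ((2 : ℤ_[2]) ^ (n + 1) ∣ coeff ij.2 (coeff ij.1 C₀)) := by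
    refine ⟨n₀, ij₀, fun hd => hc ?_⟩
    rw [hn₀, pow_succ] at hd
    exact (mul_dvd_mul_iff_left (pow_ne_zero n₀ hirr.ne_zero)).mp hd
  obtain ⟨a, ha_spec, ha_min⟩ : ∃ a : ℕ, (∃ ij : ℕ × ℕ, ¬ ((2 : ℤ_[2]) ^ (a + 1) ∣ coeff ij.2 (coeff ij.1 C₀))) ∧
      ∀ n < a, ∀ ij : ℕ × ℕ, (2 : ℤ_[2]) ^ (n + 1) ∣ coeff ij.2 (coeff ij.1 C₀) := by
    refine ⟨Nat.find hex, Nat.find_spec hex, fun n hn ij => ?_⟩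
    have hmin := Nat.find_min hex hn
    push Not at hmin
    exact hmin ij
  have hdiv : ∀ ij : ℕ × ℕ, ∃ d : ℤ_[2], coeff ij.2 (coeff ij.1 C₀) = (2 : ℤ_[2]) ^ a * d := by
    intro ij
    rcases Nat.eq_zero_or_pos a with ha | ha
    · exact ⟨coeff ij.2 (coeff ij.1 C₀), by rw [ha, pow_zero, one_mul]⟩
    · obtain ⟨n, rfl⟩ : ∃ n, a = n + 1 := ⟨a - 1, by omega⟩
      exact ha_min n (Nat.lt_succ_self n) ij
  choose d hd using hdiv
  refine ⟨a, PowerSeries.mk fun i => PowerSeries.mk fun j => J (d (i, j)), ?_, ?_⟩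
  · refine PowerSeries.ext fun i => PowerSeries.ext fun j => ?_
    rw [coeff_coeff_toUnr₂, hd (i, j), map_mul, map_pow, map_ofNat, two_pow_eq_C_C, PowerSeries.coeff_C_mul,
      PowerSeries.coeff_C_mul, PowerSeries.coeff_mk, PowerSeries.coeff_mk]
  · obtain ⟨ij₁, hij₁⟩ := ha_spec
    have hd₁ : ¬ ((2 : ℤ_[2]) ∣ d ij₁) := by
      intro h2d
      apply hij₁
      rw [hd ij₁, pow_succ]
      exact mul_dvd_mul_left _ h2d
    have hunit : IsUnit (d ij₁) := by
      by_contra hnu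
      apply hd₁
      have hmem : d ij₁ ∈ IsLocalRing.maximalIdeal ℤ_[2] :=
        (IsLocalRing.mem_maximalIdeal _).mpr (mem_nonunits_iff.mpr hnu)
      rw [PadicInt.maximalIdeal_eq_span_p, Ideal.mem_span_singleton] at hmem
      rwa [Nat.cast_ofNat] at hmem
    intro h0
    have hc := congrArg (fun F : Ω₂ => coeff ij₁.2 (coeff ij₁.1 F)) h0
    simp only [red₂, PowerSeries.coeff_map, PowerSeries.coeff_mk, map_zero, Prod.mk.eta] at hc
    exact (IsLocalRing.residue_ne_zero_iff_isUnit _).mpr (hunit.map J) hc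
end Content

/-! ## §1 Restriction of `𝒪⟦T₁,T₂⟧` to a line through the closed point (generic coefficient ring `𝒪`) -/

section LineSubst

variable {𝒪 : Type} [CommRing 𝒪]

/-- Images `u 0, u 1 ∈ T·𝒪⟦T⟧` are substitutable. -/
theorem hasSubst_line (u : Fin 2 → PowerSeries 𝒪) (hu : ∀ j, PowerSeries.constantCoeff (u j) = 0) :
    MvPowerSeries.HasSubst u :=
  MvPowerSeries.hasSubst_of_constantCoeff_zero fun j => hu j

/-- **Restriction to a line**: the continuous `𝒪`-algebra map `𝒪⟦T₂⟧⟦T₁⟧ → 𝒪⟦T⟧`, `T₁ ↦ u 0`, `T₂ ↦ u 1`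
(`u j ∈ T·𝒪⟦T⟧`), i.e. `F ↦ F(u₀(T), u₁(T))` — Mathlib's `MvPowerSeries.substAlgHom` after `𝒪⟦T₂⟧⟦T₁⟧ ≃ 𝒪⟦T₁,T₂⟧`. -/
def lineSubst (u : Fin 2 → PowerSeries 𝒪) (hu : ∀ j, PowerSeries.constantCoeff (u j) = 0) :
    PowerSeries (PowerSeries 𝒪) →+* PowerSeries 𝒪 :=
  (MvPowerSeries.substAlgHom (R := 𝒪) (hasSubst_line u hu)).toRingHom.comp
    (nestedPowerSeriesEquiv (R := 𝒪)).toRingHom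

theorem lineSubst_apply (u : Fin 2 → PowerSeries 𝒪) (hu : ∀ j, PowerSeries.constantCoeff (u j) = 0)
    (F : PowerSeries (PowerSeries 𝒪)) :
    lineSubst u hu F = MvPowerSeries.subst u (nestedPowerSeriesEquiv (R := 𝒪) F) := by
  show MvPowerSeries.substAlgHom (hasSubst_line u hu) (nestedPowerSeriesEquiv (R := 𝒪) F) = _
  rw [MvPowerSeries.coe_substAlgHom]

/-- `T₁ ↦ u 0`. -/
theorem lineSubst_X (u : Fin 2 → PowerSeries 𝒪) (hu : ∀ j, PowerSeries.constantCoeff (u j) = 0) :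
    lineSubst u hu PowerSeries.X = u 0 := by
  rw [lineSubst_apply, nestedPowerSeriesEquiv_X, MvPowerSeries.subst_X (hasSubst_line u hu)]

/-- `T₂ ↦ u 1`. -/
theorem lineSubst_C_X (u : Fin 2 → PowerSeries 𝒪) (hu : ∀ j, PowerSeries.constantCoeff (u j) = 0) :
    lineSubst u hu (PowerSeries.C PowerSeries.X) = u 1 := by
  rw [lineSubst_apply, nestedPowerSeriesEquiv_C_X, MvPowerSeries.subst_X (hasSubst_line u hu)]

/-- **Restriction to a line preserves the augmentation**: `(F|_line)(0) = F(0,0)`. -/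
theorem constantCoeff_lineSubst (u : Fin 2 → PowerSeries 𝒪) (hu : ∀ j, PowerSeries.constantCoeff (u j) = 0)
    (F : PowerSeries (PowerSeries 𝒪)) :
    PowerSeries.constantCoeff (lineSubst u hu F) = PowerSeries.constantCoeff (PowerSeries.constantCoeff F) := by
  rw [lineSubst_apply]
  show MvPowerSeries.constantCoeff (MvPowerSeries.subst u (nestedPowerSeriesEquiv (R := 𝒪) F)) = _
  rw [MvPowerSeries.constantCoeff_subst (hasSubst_line u hu), finsum_eq_single _ 0]
  · rw [Finsupp.prod_zero_index, map_one, smul_eq_mul, mul_one, coeff_nestedPowerSeriesEquiv]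
    simp
  · intro d hd
    have hs : ∃ s, d s ≠ 0 := by
      by_contra hcon
      push Not at hcon
      exact hd (Finsupp.ext fun s => by simpa using hcon s)
    obtain ⟨s, hs⟩ := hs
    have h0 : MvPowerSeries.constantCoeff (d.prod fun s e => u s ^ e) = 0 := by
      rw [map_finsuppProd, Finsupp.prod]
      exact Finset.prod_eq_zero (Finsupp.mem_support_iff.mpr hs)
        (by rw [map_pow, show MvPowerSeries.constantCoeff (u s) = 0 from hu s]; exact zero_pow hs)
    rw [h0, smul_zero]

/-- **Restriction to a line reflects units** (`𝒪⟦T₂⟧⟦T₁⟧` and `𝒪⟦T⟧` are augmented: a series is a unit iff its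
constant term is). -/
theorem isUnit_of_isUnit_lineSubst (u : Fin 2 → PowerSeries 𝒪) (hu : ∀ j, PowerSeries.constantCoeff (u j) = 0)
    {F : PowerSeries (PowerSeries 𝒪)} (h : IsUnit (lineSubst u hu F)) : IsUnit F := by
  rw [PowerSeries.isUnit_iff_constantCoeff, constantCoeff_lineSubst] at h
  exact PowerSeries.isUnit_iff_constantCoeff.mpr (PowerSeries.isUnit_iff_constantCoeff.mpr h)

/-- Restriction to a line commutes with coefficientwise maps, in the form needed here: if every coefficient of `F`
dies under `r`, so does every coefficient of `F|_line`. -/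
theorem map_lineSubst_eq_zero (u : Fin 2 → PowerSeries 𝒪) (hu : ∀ j, PowerSeries.constantCoeff (u j) = 0)
    {𝒪' : Type} [CommRing 𝒪'] (r : 𝒪 →+* 𝒪') {F : PowerSeries (PowerSeries 𝒪)}
    (hF : PowerSeries.map (PowerSeries.map r) F = 0) : PowerSeries.map r (lineSubst u hu F) = 0 := by
  have hnat : MvPowerSeries.map r (nestedPowerSeriesEquiv (R := 𝒪) F) =
      nestedPowerSeriesEquiv (R := 𝒪') (PowerSeries.map (PowerSeries.map r) F) := by
    ext d
    simp [coeff_nestedPowerSeriesEquiv, PowerSeries.coeff_map]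
  rw [lineSubst_apply]
  show MvPowerSeries.map r (MvPowerSeries.subst u (nestedPowerSeriesEquiv (R := 𝒪) F)) = 0
  rw [MvPowerSeries.map_subst (hasSubst_line u hu), hnat, hF, map_zero,
    ← MvPowerSeries.coe_substAlgHom ((hasSubst_line u hu).map r), map_zero]

end LineSubst

/-! ## §2 One-variable objects at `2` and the lines of an admissible frame -/

/-- `𝒪_{ℂ₂}⟦T⟧`. -/
abbrev A₁ : Type := PowerSeries (PadicComplexInt 2)

/-- `𝔽̄₂⟦T⟧` (`𝔽̄₂` = residue field of `𝒪_{ℂ₂}`): a discrete valuation ring; ideals `(T^λ)`. -/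
abbrev Ω₁ : Type := PowerSeries (IsLocalRing.ResidueField (PadicComplexInt 2))

/-- Coefficientwise reduction `𝒪_{ℂ₂}⟦T⟧ → 𝔽̄₂⟦T⟧`. -/
def red₁ : A₁ →+* Ω₁ := PowerSeries.map (IsLocalRing.residue (PadicComplexInt 2))

/-- `red₂ ∘ C = C ∘ red₁` (constants in the outer variable). -/
theorem red₂_C (x : A₁) : red₂ (PowerSeries.C x) = PowerSeries.C (red₁ x) := by
  show PowerSeries.map _ (PowerSeries.C x) = _
  rw [PowerSeries.map_C]
  rfl

/-- The images of `T₁, T₂` on the `ℤ₂`-quotient line with covector `(a, b)` of a frame `(γ₁, γ₂)`: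
`T₁ ↦ (1+T)^a − 1`, `T₂ ↦ (1+T)^b − 1` (outer `T₁ ↔ γ₁ ↦ a`, inner `T₂ ↔ γ₂ ↦ b`), along `J : ℤ₂ → 𝒪_{ℂ₂}`. -/
def lineImages (J : ℤ_[2] →+* PadicComplexInt 2) (a b : ℤ_[2]) : Fin 2 → A₁ :=
  ![PowerSeries.map J (PowerSeries.binomialSeries ℤ_[2] a) - 1,
    PowerSeries.map J (PowerSeries.binomialSeries ℤ_[2] b) - 1]

theorem constantCoeff_lineImages (J : ℤ_[2] →+* PadicComplexInt 2) (a b : ℤ_[2]) :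
    ∀ j, PowerSeries.constantCoeff (lineImages J a b j) = 0 := by
  have key : ∀ c : ℤ_[2],
      PowerSeries.constantCoeff (PowerSeries.map J (PowerSeries.binomialSeries ℤ_[2] c) - 1) = 0 := by
    intro c
    rw [map_sub, map_one, ← PowerSeries.coeff_zero_eq_constantCoeff_apply, PowerSeries.coeff_map,
      PowerSeries.coeff_zero_eq_constantCoeff_apply, PowerSeries.binomialSeries_constantCoeff, map_one, sub_self]
  intro j
  fin_cases j
  · exact key a
  · exact key b

/-- **Restriction of `𝒪_{ℂ₂}⟦T₁,T₂⟧` to the line `(a, b)` of the frame.** -/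
def lineRes (J : ℤ_[2] →+* PadicComplexInt 2) (a b : ℤ_[2]) : A₂ →+* A₁ :=
  lineSubst (lineImages J a b) (constantCoeff_lineImages J a b)

theorem isUnit_of_isUnit_lineRes (J : ℤ_[2] →+* PadicComplexInt 2) (a b : ℤ_[2]) :
    ∀ x : A₂, IsUnit (lineRes J a b x) → IsUnit x :=
  fun _ h => isUnit_of_isUnit_lineSubst _ _ h

/-- `μ = 0` on a line forces two-variable `μ = 0`: `red₁ (F|_line) ≠ 0 → red₂ F ≠ 0`. -/
theorem red₂_ne_zero_of_red₁_lineRes_ne_zero (J : ℤ_[2] →+* PadicComplexInt 2) (a b : ℤ_[2]) {F : A₂}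
    (h : red₁ (lineRes J a b F) ≠ 0) : red₂ F ≠ 0 :=
  fun hF => h (map_lineSubst_eq_zero _ _ (IsLocalRing.residue (PadicComplexInt 2)) hF)

/-! ## §3 The pieces (binder for binder the `∀`-frame of U of the line of record / of seat 1's `GreenbergAcFibrePinningAt`) -/

/-- **ACLR at `(E,K)`** — the research LEAF, seat 1's `N_ac ∧ Λ_ac` READ INSIDE AN ARBITRARY FRAME: for every admissible frame
datum, structure map `J`, generator `C₀` of `ch(X_Gr(E/K̃_∞))` and primitive part `C₁` of `J C₀` (`J C₀ = 2^a·C₁`, `red₂ C₁ ≠ 0`),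
there is a covector `(a', b')` of the pair `(γ₁, γ₂)` cutting out the ANTICYCLOTOMIC `ℤ₂`-extension such that on that line
(N) `μ(G|_line) = 0` and (Λ) `red(G|_line) ∣ red(C₁|_line)` in the DVR `𝔽̄₂⟦T⟧` («analytic `λ ≤` algebraic `λ`»). -/
def GreenbergAcLineReadingForallAt (W : WeierstrassCurve ℚ) [W.IsElliptic] [W.IsGloballyMinimal]
    (K : Type) [Field K] [NumberField K] : Prop :=
  ∀ [IsCMField K] (ι : PadicAlgCl 2 ≃+* ℂ) (v vbar : HeightOneSpectrum (𝓞 K)) (κ₁ κ₂ : ZpExtension K 2)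
    (γ₁ γ₂ : absoluteGaloisGroup K) [Fact (ZpExtension.IsTopGeneratorPair κ₁ κ₂ γ₁ γ₂)]
    [NeZero (W.conductorNorm ℤ)] (f : CuspForm (Gamma0 (W.conductorNorm ℤ)) 2),
    ModularForms.IsNewformOf W f → ∀ [NeZero (NumberField.discr K).natAbs],
    ((2 : ℕ) : 𝓞 K) ∈ v.asIdeal → ((2 : ℕ) : 𝓞 K) ∈ vbar.asIdeal → vbar ≠ v →
    (∀ (w : InfinitePlace K) (k : 𝓞 K), k ∈ v.asIdeal ↔ ‖ι.symm (w.embedding (k : K))‖ < 1) →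
    ∀ (Ω δ : ℂ) (Ωp : (unrIntegers 2)ˣ) (LK G : A₂),
      Ω ≠ 0 → (δ ^ 2 = (NumberField.discr K : ℂ) ∨ δ ^ 2 = -(NumberField.discr K : ℂ)) →
      IsKatzMeasure₂ ι v vbar ∅ κ₁ κ₂ γ₁⁻¹ γ₂⁻¹ 1 Ω δ ((Ωp : unrIntegers 2) : ℂ_[2]) LK →
      IsGreenbergLFunctionFree₂ ι v vbar κ₁ κ₂ γ₁⁻¹ γ₂⁻¹ f (NumberField.discr K).natAbs
        (NumberField.classNumber K) LK G →
      ∀ J : ℤ_[2] →+* PadicComplexInt 2,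
        (∀ x : ℤ_[2], ((J x : PadicComplexInt 2) : ℂ_[2]) = ((x : ℚ_[2]) : ℂ_[2])) →
        ∀ C₀ : IwasawaAlgebra₂ 2,
          WeierstrassCurve.XGr₂.charIdeal (W.baseChange K) 2 κ₁ κ₂ vbar γ₁ γ₂ = Ideal.span {C₀} →
          ∀ (a : ℕ) (C₁ : A₂), toUnr₂ 2 J C₀ = (2 : A₂) ^ a * C₁ → red₂ C₁ ≠ 0 →
            ∃ (a' b' : ℤ_[2]) (hab : IsUnit a' ∨ IsUnit b'),
              (ZpExtension.ofLinComb (Fact.out : ZpExtension.IsTopGeneratorPair κ₁ κ₂ γ₁ γ₂) a' b' hab).IsAnticyclotomic ∧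
              red₁ (lineRes J a' b' G) ≠ 0 ∧ red₁ (lineRes J a' b' G) ∣ red₁ (lineRes J a' b' C₁)

/-- **LINEDVD at `(E,K)`** — the WEAKER seam actually consumed by the kernel: (N) ∧ (Λ) on SOME `ℤ₂`-quotient line `(a', b')`
of the frame (no anticyclotomicity asked). -/
def GreenbergLineDvdForallAt (W : WeierstrassCurve ℚ) [W.IsElliptic] [W.IsGloballyMinimal]
    (K : Type) [Field K] [NumberField K] : Prop :=
  ∀ [IsCMField K] (ι : PadicAlgCl 2 ≃+* ℂ) (v vbar : HeightOneSpectrum (𝓞 K)) (κ₁ κ₂ : ZpExtension K 2)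
    (γ₁ γ₂ : absoluteGaloisGroup K) [Fact (ZpExtension.IsTopGeneratorPair κ₁ κ₂ γ₁ γ₂)]
    [NeZero (W.conductorNorm ℤ)] (f : CuspForm (Gamma0 (W.conductorNorm ℤ)) 2),
    ModularForms.IsNewformOf W f → ∀ [NeZero (NumberField.discr K).natAbs],
    ((2 : ℕ) : 𝓞 K) ∈ v.asIdeal → ((2 : ℕ) : 𝓞 K) ∈ vbar.asIdeal → vbar ≠ v →
    (∀ (w : InfinitePlace K) (k : 𝓞 K), k ∈ v.asIdeal ↔ ‖ι.symm (w.embedding (k : K))‖ < 1) →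
    ∀ (Ω δ : ℂ) (Ωp : (unrIntegers 2)ˣ) (LK G : A₂),
      Ω ≠ 0 → (δ ^ 2 = (NumberField.discr K : ℂ) ∨ δ ^ 2 = -(NumberField.discr K : ℂ)) →
      IsKatzMeasure₂ ι v vbar ∅ κ₁ κ₂ γ₁⁻¹ γ₂⁻¹ 1 Ω δ ((Ωp : unrIntegers 2) : ℂ_[2]) LK →
      IsGreenbergLFunctionFree₂ ι v vbar κ₁ κ₂ γ₁⁻¹ γ₂⁻¹ f (NumberField.discr K).natAbs
        (NumberField.classNumber K) LK G →
      ∀ J : ℤ_[2] →+* PadicComplexInt 2,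
        (∀ x : ℤ_[2], ((J x : PadicComplexInt 2) : ℂ_[2]) = ((x : ℚ_[2]) : ℂ_[2])) →
        ∀ C₀ : IwasawaAlgebra₂ 2,
          WeierstrassCurve.XGr₂.charIdeal (W.baseChange K) 2 κ₁ κ₂ vbar γ₁ γ₂ = Ideal.span {C₀} →
          ∀ (a : ℕ) (C₁ : A₂), toUnr₂ 2 J C₀ = (2 : A₂) ^ a * C₁ → red₂ C₁ ≠ 0 →
            ∃ (a' b' : ℤ_[2]), red₁ (lineRes J a' b' G) ≠ 0 ∧ red₁ (lineRes J a' b' G) ∣ red₁ (lineRes J a' b' C₁)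

/-- ACLR on the habitat (β) of O2 — research grade, THE leaf of this annex (= seat 1's `N_ac ∧ Λ_ac`, all pairs). -/
def AcLineReadingAtTwo : Prop :=
  ∀ (W : WeierstrassCurve ℚ) [W.IsElliptic] [W.IsGloballyMinimal],
    ¬ W.HasCM → GoodOrd W 2 → ¬ W.HasIrreducibleModPGaloisRep 2 →
    ∀ (K : Type) [Field K] [NumberField K],
      (IsImaginaryQuadratic K ∧ SatisfiesHeegnerHypothesis (2 * W.conductorNorm ℤ) K) →
      GreenbergAcLineReadingForallAt W K

/-- LINEDVD on the habitat (β) of O2 (the weaker seam). -/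
def LineDvdAtTwo : Prop :=
  ∀ (W : WeierstrassCurve ℚ) [W.IsElliptic] [W.IsGloballyMinimal],
    ¬ W.HasCM → GoodOrd W 2 → ¬ W.HasIrreducibleModPGaloisRep 2 →
    ∀ (K : Type) [Field K] [NumberField K],
      (IsImaginaryQuadratic K ∧ SatisfiesHeegnerHypothesis (2 * W.conductorNorm ℤ) K) →
      GreenbergLineDvdForallAt W K

theorem lineDvdAtTwo_of_acLineReadingAtTwo : AcLineReadingAtTwo → LineDvdAtTwo := by
  intro h W _ _ hCM hGO hβ K _ _ hK _ ι v vbar κ₁ κ₂ γ₁ γ₂ _ _ f hf _ hv hvbar hne hι Ω δ Ωp LK G hΩ hδ hLK hG J hJ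
    C₀ hC a C₁ hC₁ hred
  obtain ⟨a', b', _, _, hN, hΛ⟩ :=
    h W hCM hGO hβ K hK ι v vbar κ₁ κ₂ γ₁ γ₂ f hf hv hvbar hne hι Ω δ Ωp LK G hΩ hδ hLK hG J hJ C₀ hC a C₁ hC₁ hred
  exact ⟨a', b', hN, hΛ⟩

/-! ## §4 Kernel algebra (sorry-free) -/

/-- A series in `𝒪_{ℂ₂}⟦T⟧` whose reduction is a unit of `𝔽̄₂⟦T⟧` is a unit. -/
theorem isUnit_of_isUnit_red₁ {x : A₁} (h : IsUnit (red₁ x)) : IsUnit x := by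
  rw [PowerSeries.isUnit_iff_constantCoeff] at h ⊢
  have hc : PowerSeries.constantCoeff (red₁ x) =
      IsLocalRing.residue (PadicComplexInt 2) (PowerSeries.constantCoeff x) := by
    show PowerSeries.constantCoeff (PowerSeries.map _ x) = _
    rw [← PowerSeries.coeff_zero_eq_constantCoeff_apply, PowerSeries.coeff_map,
      PowerSeries.coeff_zero_eq_constantCoeff_apply]
  rw [hc] at h
  exact (IsLocalRing.residue_ne_zero_iff_isUnit _).mp h.ne_zero

/-- **The Gauss pin through a unit-reflecting ring map to `𝒪_{ℂ₂}⟦T⟧`** (pure commutative algebra over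
`A₂ = 𝒪_{ℂ₂}⟦T₁,T₂⟧`): if `2^n·G = F·h` with `red₂ F ≠ 0` (primitive `F`), and for SOME ring map `φ : A₂ → 𝒪_{ℂ₂}⟦T⟧` reflecting
units one has (N) `red₁(φ G) ≠ 0` and (Λ) `red₁(φ G) ∣ red₁(φ F)` in `𝔽̄₂⟦T⟧`, then `(F) ⊆ (G)`.  Proof: Gauss content (p766427) ⇒
`h = 2^n h₀`, `G = F h₀`; reduce along `φ`: `Ḡ = F̄ h̄₀ = q Ḡ h̄₀` in the domain `𝔽̄₂⟦T⟧` with `Ḡ ≠ 0` ⇒ `q h̄₀ = 1` ⇒ `h̄₀`, hence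
`φ h₀`, hence `h₀` is a unit.  (Lead's `TwoAdicBDPLinePin`: the case `φ = constantCoeff` / `map constantCoeff`; seat 1's
`PrimePinning₂`: the case «reduce first, then a prime `𝔓` of the special fibre».) -/
theorem span_le_span_of_two_pow_mul_eq_of_lineDvd (φ : A₂ →+* A₁) (hφ : ∀ x : A₂, IsUnit (φ x) → IsUnit x)
    (F G h : A₂) (n : ℕ) (hFh : (2 : A₂) ^ n * G = F * h) (hF : red₂ F ≠ 0) (hN : red₁ (φ G) ≠ 0)
    (hΛ : red₁ (φ G) ∣ red₁ (φ F)) : Ideal.span {F} ≤ Ideal.span {G} := by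
  have hFh' : ((2 : ℕ) : A₂) ^ n * G = F * h := by rw [Nat.cast_ofNat]; exact hFh
  have hFu : ∃ i : ℕ × ℕ, IsUnit (PowerSeries.coeff i.2 (PowerSeries.coeff i.1 F)) :=
    exists_isUnit_coeff_of_map_map_residue_ne_zero hF
  have hdvd : PowerSeries.C (PowerSeries.C (((2 : ℕ) : PadicComplexInt 2) ^ n)) ∣ F * h :=
    ⟨G, by rw [← hFh', natCast_pow_eq_C_C]⟩
  obtain ⟨h₀, rfl⟩ := C_C_dvd_of_C_C_dvd_mul_of_exists_isUnit_coeff hFu hdvd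
  have hG : G = F * h₀ := by
    refine mul_left_cancel₀ (C_C_ne_zero (pow_ne_zero n (natCast_prime_padicComplexInt_ne_zero (p := 2)))) ?_
    rw [← natCast_pow_eq_C_C, hFh', natCast_pow_eq_C_C]; ring
  obtain ⟨q, hq⟩ := hΛ
  -- in the domain `𝔽̄₂⟦T⟧`: `Ḡ = F̄·h̄₀ = Ḡ·q·h̄₀`, `Ḡ ≠ 0` ⇒ `q·h̄₀ = 1`
  have hunit : IsUnit (red₁ (φ h₀)) := by
    have h1 : red₁ (φ G) * (q * red₁ (φ h₀) - 1) = 0 := by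
      rw [mul_sub, mul_one, sub_eq_zero, ← mul_assoc, ← hq, ← map_mul, ← map_mul, ← hG]
    rcases mul_eq_zero.mp h1 with h0 | h0
    · exact absurd h0 hN
    · exact isUnit_iff_exists_inv'.mpr ⟨q, sub_eq_zero.mp h0⟩
  obtain ⟨u, hu⟩ := hφ h₀ (isUnit_of_isUnit_red₁ hunit)
  refine Ideal.span_singleton_le_span_singleton.mpr ⟨↑u⁻¹, ?_⟩
  rw [hG, ← hu, mul_assoc, Units.mul_inv, mul_one]

/-- **THE NODE, sorry-free**: `O2 ⟸ P0 ∧ CONTENT ∧ U ∧ R0T ∧ LINEDVD` (logic + the Gauss pin on a line of the frame). -/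
theorem bdpSelmerLowerDivisibilityAtTwo_of_lineDvd :
    XGr₂CharIdealPrincipalAtTwo → TwoContent₂ → TwoVariableUpperInclusionRatAtTwo → TwoVariableFrameTorsionAtTwo →
      LineDvdAtTwo → BDPSelmerLowerDivisibilityAtTwo := by
  intro hP hCt hU h0 hpin W _ _ hCM hGO hβ K _ _ hK _ ι v vbar κ₁ κ₂ γ₁ γ₂ _ _ f hf _ hv hvbar hne hι
  obtain ⟨Ω, δ, Ωp, LK, G, hΩ, hδ, hLK, hG, htor⟩ :=
    h0 W hCM hGO hβ K hK ι v vbar κ₁ κ₂ γ₁ γ₂ f hf hv hvbar hne hι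
  refine ⟨Ω, δ, Ωp, LK, G, hΩ, hδ, hLK, hG, htor, fun J hJ => ?_⟩
  obtain ⟨C₀, hC⟩ := hP W K vbar κ₁ κ₂ γ₁ γ₂ htor
  rw [hC, Ideal.map_span, Set.image_singleton]
  by_cases hC0 : C₀ = 0
  · rw [hC0, map_zero, Ideal.span_singleton_zero]
    exact bot_le
  obtain ⟨a, C₁, hC₁, hred⟩ := hCt J C₀ hC0
  obtain ⟨m, hm⟩ := hU W hCM hGO hβ K hK ι v vbar κ₁ κ₂ γ₁ γ₂ f hf hv hvbar hne hι Ω δ Ωp LK G hΩ hδ hLK hG J hJ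
  rw [hC, Ideal.map_span, Set.image_singleton] at hm
  obtain ⟨h, hh⟩ := Ideal.mem_span_singleton'.mp (hm (Ideal.mem_span_singleton_self _))
  have hFh : (2 : A₂) ^ m * G = C₁ * ((2 : A₂) ^ a * h) := by rw [← hh, hC₁]; ring
  obtain ⟨a', b', hN, hΛ⟩ :=
    hpin W hCM hGO hβ K hK ι v vbar κ₁ κ₂ γ₁ γ₂ f hf hv hvbar hne hι Ω δ Ωp LK G hΩ hδ hLK hG J hJ C₀ hC a C₁ hC₁ hred
  have hle : Ideal.span {C₁} ≤ Ideal.span {G} :=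
    span_le_span_of_two_pow_mul_eq_of_lineDvd (lineRes J a' b') (isUnit_of_isUnit_lineRes J a' b') C₁ G _ m hFh hred
      hN hΛ
  exact le_trans (Ideal.span_singleton_le_span_singleton.mpr ⟨(2 : A₂) ^ a, by rw [hC₁, mul_comm]⟩) hle

/-- **THE NODE with the research leaf**: `O2 ⟸ P0 ∧ CONTENT ∧ U ∧ R0T ∧ ACLR`, sorry-free. -/
theorem bdpSelmerLowerDivisibilityAtTwo_of_acLineReading :
    XGr₂CharIdealPrincipalAtTwo → TwoContent₂ → TwoVariableUpperInclusionRatAtTwo → TwoVariableFrameTorsionAtTwo →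
      AcLineReadingAtTwo → BDPSelmerLowerDivisibilityAtTwo :=
  fun hP hCt hU h0 hac =>
    bdpSelmerLowerDivisibilityAtTwo_of_lineDvd hP hCt hU h0 (lineDvdAtTwo_of_acLineReadingAtTwo hac)

/-! ## §5 (GEN 9, new) PINNING AT THE CONSUMER'S PRIME: (N) ∧ (Λ) on the CYCLOTOMIC `ℤ₂`-line of the frame

The cyclotomic `ℤ₂`-extension `κ` of `K` (`ZpExtension.IsCyclotomic κ`: `ker κ = χ₂⁻¹(μ(ℤ₂))`) exists (tree
`ZpExtension.exists_isCyclotomic_holds`, from `GaloisRep.cyclotomicCharacter_range_infinite`), lies in the tower of EVERY presented pair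
(`IsTopGeneratorPair.pairKer_le_kerSubgroup`, `[K:ℚ] ≤ 2`) and is there the `ℤ₂`-combination `κ = κ(γ₁)·κ₁ + κ(γ₂)·κ₂`; its covector
`(κγ₁, κγ₂)` is PRIMITIVE (`isUnit_or_isUnit_of_line`), «restriction of `F ∈ 𝒪_{ℂ₂}⟦T₁,T₂⟧` to the cyclotomic line» is
`lineRes J (κγ₁) (κγ₂) F` with NO existential, and `𝔓_cyc := ker (redLineRes J (κγ₁) (κγ₂))` is a prime of `𝔽̄₂⟦T₁,T₂⟧`
(`𝔽̄₂⟦T⟧` is a domain) — the prime at which the consumer 6‴ reads `λ` (seat 1 GEN 7: in a cyclotomically adapted frame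
`κ = κ₁`, covector `(1, 0)`, and the reading is seat 1's `shadow = line₁ ∘ red₂`; the bridge is the kernel leaf L2 of §7).

Leaves of N_cyc / Λ_cyc (informal; the card tags them): RIP (ramified-twist interpolation on one cone-interior translate of the
cyclotomic line — the STRENGTHENED frame), VC (value-level Eisenstein congruence mod a fixed `2^c` at the deep twists), DP (§5c),
N^{Katz}_cyc (`red LK ∉ 𝔓_cyc`, GL(1) print at `2`), ALG_cyc (v7's R_alg ∧ R_KMC restricted to `𝔓_cyc`).  Mechanism: with
`μ(LK·LK'·∏Euler |_ℓ) = 0` (N^{Katz}) the deep values of the Eisenstein model have `v₂ → 0`; a congruence of fixed depth `c` (VC)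
then forces `v₂(G|_ℓ(z_k)) = v₂(M|_ℓ(z_k))` for `k ≫ 0`, i.e. (DP) `μ(G|_ℓ) = 0` and `λ(G|_ℓ) = λ(M|_ℓ)`; by (a) these are the
`𝔓_cyc`-orders of `red G` and `red M`, in EVERY frame; ALG_cyc gives `ord_{𝔓_cyc}`-side `λ_cyc(C₁) = λ_cyc(M)`; hence N_cyc and
Λ_cyc (with equality). -/

section MapLineSubst

variable {𝒪 : Type} [CommRing 𝒪]

/-- Restriction to a line COMMUTES with coefficientwise maps (general form of §1's `map_lineSubst_eq_zero`). -/
theorem map_lineSubst (u : Fin 2 → PowerSeries 𝒪) (hu : ∀ j, PowerSeries.constantCoeff (u j) = 0)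
    {𝒪' : Type} [CommRing 𝒪'] (r : 𝒪 →+* 𝒪') (F : PowerSeries (PowerSeries 𝒪))
    (hu' : ∀ j, PowerSeries.constantCoeff (PowerSeries.map r (u j)) = 0) :
    PowerSeries.map r (lineSubst u hu F) =
      lineSubst (fun j => PowerSeries.map r (u j)) hu' (PowerSeries.map (PowerSeries.map r) F) := by
  have hnat : MvPowerSeries.map r (nestedPowerSeriesEquiv (R := 𝒪) F) =
      nestedPowerSeriesEquiv (R := 𝒪') (PowerSeries.map (PowerSeries.map r) F) := by
    ext d
    simp [coeff_nestedPowerSeriesEquiv, PowerSeries.coeff_map]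
  rw [lineSubst_apply, lineSubst_apply]
  show MvPowerSeries.map r (MvPowerSeries.subst u (nestedPowerSeriesEquiv (R := 𝒪) F)) = _
  rw [MvPowerSeries.map_subst (hasSubst_line u hu), hnat]
  rfl

end MapLineSubst

theorem constantCoeff_red₁_lineImages (J : ℤ_[2] →+* PadicComplexInt 2) (a b : ℤ_[2]) :
    ∀ j, PowerSeries.constantCoeff (PowerSeries.map (IsLocalRing.residue (PadicComplexInt 2)) (lineImages J a b j)) = 0 := by
  intro j
  rw [← PowerSeries.coeff_zero_eq_constantCoeff_apply, PowerSeries.coeff_map, PowerSeries.coeff_zero_eq_constantCoeff_apply,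
    constantCoeff_lineImages J a b j, map_zero]

/-- **The RESIDUAL line functional** `𝔽̄₂⟦T₁,T₂⟧ → 𝔽̄₂⟦T⟧` of the line with covector `(a, b)`: substitute the reduced images
`red((1+T)^a − 1)`, `red((1+T)^b − 1)`.  Its kernel `𝔓_{(a,b)}` is the RESIDUAL PRIME of the line (prime: `𝔽̄₂⟦T⟧` is a domain);
all translates of the line by characters have the same residual prime. -/
def redLineRes (J : ℤ_[2] →+* PadicComplexInt 2) (a b : ℤ_[2]) : Ω₂ →+* Ω₁ :=
  lineSubst (fun j => PowerSeries.map (IsLocalRing.residue (PadicComplexInt 2)) (lineImages J a b j))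
    (constantCoeff_red₁_lineImages J a b)

/-- `redLineRes ∘ red₂ = red₁ ∘ lineRes` (reduce-then-restrict = restrict-then-reduce). KERNEL, proved. -/
theorem redLineRes_red₂ (J : ℤ_[2] →+* PadicComplexInt 2) (a b : ℤ_[2]) (x : A₂) :
    redLineRes J a b (red₂ x) = red₁ (lineRes J a b x) :=
  (map_lineSubst (lineImages J a b) (constantCoeff_lineImages J a b) (IsLocalRing.residue (PadicComplexInt 2)) x
    (constantCoeff_red₁_lineImages J a b)).symm

/-- **PRIMITIVITY of the covector of a line through a presented pair** (`[K:ℚ] ≤ 2`, every `p`; here `p = 2`): for a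
generator pair `(κ₁, κ₂; γ₁, γ₂)` and ANY `ℤ₂`-extension `κ` of `K`, one of `κ γ₁`, `κ γ₂` is a unit of `ℤ₂`
(`κ = κ(γ₁)κ₁ + κ(γ₂)κ₂` is onto `ℤ₂`).  KERNEL, proved from the tree's pair-tower universality. -/
theorem isUnit_or_isUnit_of_line {K : Type} [Field K] [NumberField K] (hK2 : Module.finrank ℚ K ≤ 2)
    {κ₁ κ₂ : ZpExtension K 2} {γ₁ γ₂ : absoluteGaloisGroup K} (hpair : ZpExtension.IsTopGeneratorPair κ₁ κ₂ γ₁ γ₂)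
    (κ : ZpExtension K 2) :
    IsUnit (Multiplicative.toAdd (κ γ₁)) ∨ IsUnit (Multiplicative.toAdd (κ γ₂)) := by
  by_contra h
  push Not at h
  obtain ⟨σ, hσ⟩ : ∃ σ : absoluteGaloisGroup K, κ σ = Multiplicative.ofAdd 1 :=
    κ.surjective (Multiplicative.ofAdd 1)
  have key := hpair.toAdd_apply_eq_of_pairKer_le (hpair.pairKer_le_kerSubgroup hK2 κ) σ
  rw [hσ, toAdd_ofAdd] at key
  have hm : ∀ x : ℤ_[2], ¬ IsUnit x → x ∈ IsLocalRing.maximalIdeal ℤ_[2] := fun x hx =>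
    (IsLocalRing.mem_maximalIdeal _).mpr (mem_nonunits_iff.mpr hx)
  have h1 : (1 : ℤ_[2]) ∈ IsLocalRing.maximalIdeal ℤ_[2] := by
    rw [key]
    exact Ideal.add_mem _ (Ideal.mul_mem_right _ _ (hm _ h.1)) (Ideal.mul_mem_right _ _ (hm _ h.2))
  exact (IsLocalRing.maximalIdeal.isMaximal ℤ_[2]).ne_top ((Ideal.eq_top_iff_one _).mpr h1)

/-- **N_cyc at `(E,K)`** (piece, UNDECIDED vs the crux; `μ`-half): for every admissible frame datum and structure map `J`, on
every CYCLOTOMIC `ℤ₂`-line `κ` of `K` (covector `(κγ₁, κγ₂)` in the frame): `red(G|_κ) ≠ 0`, i.e. `μ` of the cyclotomic shadow of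
`G` vanishes — `red G ∉ 𝔓_cyc`.  [⟸ RIP ∧ VC ∧ DP ∧ N^{Katz}_cyc.]  WHY IT MIGHT FAIL: `red G ∈ 𝔓_cyc` (the residual Greenberg
function vanishes identically on the cyclotomic residual line — then 6‴'s `λ`-currency is void and seat 1's O2′ fails too). -/
def GreenbergCycLineMuZeroForallAt (W : WeierstrassCurve ℚ) [W.IsElliptic] [W.IsGloballyMinimal]
    (K : Type) [Field K] [NumberField K] : Prop :=
  ∀ [IsCMField K] (ι : PadicAlgCl 2 ≃+* ℂ) (v vbar : HeightOneSpectrum (𝓞 K)) (κ₁ κ₂ : ZpExtension K 2)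
    (γ₁ γ₂ : absoluteGaloisGroup K) [Fact (ZpExtension.IsTopGeneratorPair κ₁ κ₂ γ₁ γ₂)]
    [NeZero (W.conductorNorm ℤ)] (f : CuspForm (Gamma0 (W.conductorNorm ℤ)) 2),
    ModularForms.IsNewformOf W f → ∀ [NeZero (NumberField.discr K).natAbs],
    ((2 : ℕ) : 𝓞 K) ∈ v.asIdeal → ((2 : ℕ) : 𝓞 K) ∈ vbar.asIdeal → vbar ≠ v →
    (∀ (w : InfinitePlace K) (k : 𝓞 K), k ∈ v.asIdeal ↔ ‖ι.symm (w.embedding (k : K))‖ < 1) →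
    ∀ (Ω δ : ℂ) (Ωp : (unrIntegers 2)ˣ) (LK G : A₂),
      Ω ≠ 0 → (δ ^ 2 = (NumberField.discr K : ℂ) ∨ δ ^ 2 = -(NumberField.discr K : ℂ)) →
      IsKatzMeasure₂ ι v vbar ∅ κ₁ κ₂ γ₁⁻¹ γ₂⁻¹ 1 Ω δ ((Ωp : unrIntegers 2) : ℂ_[2]) LK →
      IsGreenbergLFunctionFree₂ ι v vbar κ₁ κ₂ γ₁⁻¹ γ₂⁻¹ f (NumberField.discr K).natAbs
        (NumberField.classNumber K) LK G →
      ∀ J : ℤ_[2] →+* PadicComplexInt 2,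
        (∀ x : ℤ_[2], ((J x : PadicComplexInt 2) : ℂ_[2]) = ((x : ℚ_[2]) : ℂ_[2])) →
        ∀ κ : ZpExtension K 2, κ.IsCyclotomic →
          red₁ (lineRes J (Multiplicative.toAdd (κ γ₁)) (Multiplicative.toAdd (κ γ₂)) G) ≠ 0

/-- **Λ_cyc at `(E,K)`** (piece, WEAKER than O2 ∧ U ∧ N_cyc; `λ`-half, Eisenstein direction): for every admissible frame datum, `J`,
generator `C₀` of `ch_{Λ_K}(X_Gr₂)` and primitive part `C₁` of `J C₀` (`J C₀ = 2^a·C₁`, `red C₁ ≠ 0`), on every cyclotomic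
`ℤ₂`-line `κ`: `red(G|_κ) ∣ red(C₁|_κ)` in the DVR `𝔽̄₂⟦T⟧` — given N_cyc, exactly `λ_cyc(G) ≤ λ_cyc(C₁)`, the inequality the
consumer 6‴ reads.  [⟸ RIP ∧ VC ∧ DP ∧ N^{Katz}_cyc ∧ ALG_cyc, with EQUALITY.]  WHY IT MIGHT FAIL: a `2`-adic unit discrepancy
between the Greenberg and the Katz-squared normalisations at `2` that is NOT a residual unit on the cyclotomic residual line
(the R0G wall: Hida's CM projector / congruence number of `θ_ξ` at `2` when `ρ̄_θ = 𝟙 ⊕ 𝟙`). -/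
def GreenbergCycLineLambdaForallAt (W : WeierstrassCurve ℚ) [W.IsElliptic] [W.IsGloballyMinimal]
    (K : Type) [Field K] [NumberField K] : Prop :=
  ∀ [IsCMField K] (ι : PadicAlgCl 2 ≃+* ℂ) (v vbar : HeightOneSpectrum (𝓞 K)) (κ₁ κ₂ : ZpExtension K 2)
    (γ₁ γ₂ : absoluteGaloisGroup K) [Fact (ZpExtension.IsTopGeneratorPair κ₁ κ₂ γ₁ γ₂)]
    [NeZero (W.conductorNorm ℤ)] (f : CuspForm (Gamma0 (W.conductorNorm ℤ)) 2),
    ModularForms.IsNewformOf W f → ∀ [NeZero (NumberField.discr K).natAbs],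
    ((2 : ℕ) : 𝓞 K) ∈ v.asIdeal → ((2 : ℕ) : 𝓞 K) ∈ vbar.asIdeal → vbar ≠ v →
    (∀ (w : InfinitePlace K) (k : 𝓞 K), k ∈ v.asIdeal ↔ ‖ι.symm (w.embedding (k : K))‖ < 1) →
    ∀ (Ω δ : ℂ) (Ωp : (unrIntegers 2)ˣ) (LK G : A₂),
      Ω ≠ 0 → (δ ^ 2 = (NumberField.discr K : ℂ) ∨ δ ^ 2 = -(NumberField.discr K : ℂ)) →
      IsKatzMeasure₂ ι v vbar ∅ κ₁ κ₂ γ₁⁻¹ γ₂⁻¹ 1 Ω δ ((Ωp : unrIntegers 2) : ℂ_[2]) LK →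
      IsGreenbergLFunctionFree₂ ι v vbar κ₁ κ₂ γ₁⁻¹ γ₂⁻¹ f (NumberField.discr K).natAbs
        (NumberField.classNumber K) LK G →
      ∀ J : ℤ_[2] →+* PadicComplexInt 2,
        (∀ x : ℤ_[2], ((J x : PadicComplexInt 2) : ℂ_[2]) = ((x : ℚ_[2]) : ℂ_[2])) →
        ∀ C₀ : IwasawaAlgebra₂ 2,
          WeierstrassCurve.XGr₂.charIdeal (W.baseChange K) 2 κ₁ κ₂ vbar γ₁ γ₂ = Ideal.span {C₀} →
          ∀ (a : ℕ) (C₁ : A₂), toUnr₂ 2 J C₀ = (2 : A₂) ^ a * C₁ → red₂ C₁ ≠ 0 →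
            ∀ κ : ZpExtension K 2, κ.IsCyclotomic →
              red₁ (lineRes J (Multiplicative.toAdd (κ γ₁)) (Multiplicative.toAdd (κ γ₂)) G) ∣
                red₁ (lineRes J (Multiplicative.toAdd (κ γ₁)) (Multiplicative.toAdd (κ γ₂)) C₁)

/-- N_cyc on the habitat (β) of O2. -/
def CycLineMuZeroAtTwo : Prop :=
  ∀ (W : WeierstrassCurve ℚ) [W.IsElliptic] [W.IsGloballyMinimal],
    ¬ W.HasCM → GoodOrd W 2 → ¬ W.HasIrreducibleModPGaloisRep 2 →
    ∀ (K : Type) [Field K] [NumberField K],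
      (IsImaginaryQuadratic K ∧ SatisfiesHeegnerHypothesis (2 * W.conductorNorm ℤ) K) →
      GreenbergCycLineMuZeroForallAt W K

/-- Λ_cyc on the habitat (β) of O2. -/
def CycLineLambdaAtTwo : Prop :=
  ∀ (W : WeierstrassCurve ℚ) [W.IsElliptic] [W.IsGloballyMinimal],
    ¬ W.HasCM → GoodOrd W 2 → ¬ W.HasIrreducibleModPGaloisRep 2 →
    ∀ (K : Type) [Field K] [NumberField K],
      (IsImaginaryQuadratic K ∧ SatisfiesHeegnerHypothesis (2 * W.conductorNorm ℤ) K) →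
      GreenbergCycLineLambdaForallAt W K

/-- **SEAM (KERNEL, proved): N_cyc ∧ Λ_cyc ⟹ LINEDVD.**  The cyclotomic line exists in every frame (tree
`ZpExtension.exists_isCyclotomic_holds`), so the cyclotomic reading supplies the line g3's Gauss-pin road consumes. -/
theorem lineDvdAtTwo_of_cycLine : CycLineMuZeroAtTwo → CycLineLambdaAtTwo → LineDvdAtTwo := by
  intro hN hΛ W _ _ hCM hGO hβ K _ _ hK _ ι v vbar κ₁ κ₂ γ₁ γ₂ _ _ f hf _ hv hvbar hne hι Ω δ Ωp LK G hΩ hδ hLK hG J hJ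
    C₀ hC a C₁ hC₁ hred
  obtain ⟨κ, hκ⟩ := ZpExtension.exists_isCyclotomic_holds K 2 (GaloisRep.cyclotomicCharacter_range_infinite K 2)
  exact ⟨_, _, hN W hCM hGO hβ K hK ι v vbar κ₁ κ₂ γ₁ γ₂ f hf hv hvbar hne hι Ω δ Ωp LK G hΩ hδ hLK hG J hJ κ hκ,
    hΛ W hCM hGO hβ K hK ι v vbar κ₁ κ₂ γ₁ γ₂ f hf hv hvbar hne hι Ω δ Ωp LK G hΩ hδ hLK hG J hJ C₀ hC a C₁ hC₁ hred κ hκ⟩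

/-- **THE NODE, architecture (i) (sorry-free): O2 ⟸ P0 ∧ CONTENT ∧ U ∧ R0T ∧ N_cyc ∧ Λ_cyc** (logic + g3's unit-reflecting Gauss pin
on the cyclotomic line of the frame). -/
theorem bdpSelmerLowerDivisibilityAtTwo_of_cycLine :
    XGr₂CharIdealPrincipalAtTwo → TwoContent₂ → TwoVariableUpperInclusionRatAtTwo → TwoVariableFrameTorsionAtTwo →
      CycLineMuZeroAtTwo → CycLineLambdaAtTwo → BDPSelmerLowerDivisibilityAtTwo :=
  fun hP hCt hU h0 hN hΛ => bdpSelmerLowerDivisibilityAtTwo_of_lineDvd hP hCt hU h0 (lineDvdAtTwo_of_cycLine hN hΛ)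

/-! ### §5b The same leaf in v7's ACPIN currency (`FibrePinned`, seat 1 / line of record v7, VERBATIM decls) -/

/-- **FibrePinned G C'** (v7 / seat 1, verbatim) — SOME prime `𝔓` of `𝔽̄₂⟦T₁,T₂⟧` with (N) `red G ∉ 𝔓` and (Λ) for every
primitive part `C₁` of `C'` (`C' = 2^a·C₁`, `red C₁ ≠ 0`): `red C₁ ∈ 𝔓 + (red G)`. -/
def FibrePinned (G C' : A₂) : Prop :=
  ∃ 𝔓 : Ideal Ω₂, 𝔓.IsPrime ∧ red₂ G ∉ 𝔓 ∧
    ∀ (a : ℕ) (C₁ : A₂), C' = (2 : A₂) ^ a * C₁ → red₂ C₁ ≠ 0 → red₂ C₁ ∈ 𝔓 ⊔ Ideal.span {red₂ G}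

/-- **ACPIN at `(E,K)`** (v7 / seat 1, verbatim). -/
def GreenbergAcFibrePinningAt (W : WeierstrassCurve ℚ) [W.IsElliptic] [W.IsGloballyMinimal]
    (K : Type) [Field K] [NumberField K] : Prop :=
  ∀ [IsCMField K] (ι : PadicAlgCl 2 ≃+* ℂ) (v vbar : HeightOneSpectrum (𝓞 K)) (κ₁ κ₂ : ZpExtension K 2)
    (γ₁ γ₂ : absoluteGaloisGroup K) [Fact (ZpExtension.IsTopGeneratorPair κ₁ κ₂ γ₁ γ₂)]
    [NeZero (W.conductorNorm ℤ)] (f : CuspForm (Gamma0 (W.conductorNorm ℤ)) 2),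
    ModularForms.IsNewformOf W f → ∀ [NeZero (NumberField.discr K).natAbs],
    ((2 : ℕ) : 𝓞 K) ∈ v.asIdeal → ((2 : ℕ) : 𝓞 K) ∈ vbar.asIdeal → vbar ≠ v →
    (∀ (w : InfinitePlace K) (k : 𝓞 K), k ∈ v.asIdeal ↔ ‖ι.symm (w.embedding (k : K))‖ < 1) →
    ∀ (Ω δ : ℂ) (Ωp : (unrIntegers 2)ˣ) (LK G : A₂),
      Ω ≠ 0 → (δ ^ 2 = (NumberField.discr K : ℂ) ∨ δ ^ 2 = -(NumberField.discr K : ℂ)) →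
      IsKatzMeasure₂ ι v vbar ∅ κ₁ κ₂ γ₁⁻¹ γ₂⁻¹ 1 Ω δ ((Ωp : unrIntegers 2) : ℂ_[2]) LK →
      IsGreenbergLFunctionFree₂ ι v vbar κ₁ κ₂ γ₁⁻¹ γ₂⁻¹ f (NumberField.discr K).natAbs
        (NumberField.classNumber K) LK G →
      ∀ J : ℤ_[2] →+* PadicComplexInt 2,
        (∀ x : ℤ_[2], ((J x : PadicComplexInt 2) : ℂ_[2]) = ((x : ℚ_[2]) : ℂ_[2])) →
        ∀ C₀ : IwasawaAlgebra₂ 2,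
          WeierstrassCurve.XGr₂.charIdeal (W.baseChange K) 2 κ₁ κ₂ vbar γ₁ γ₂ = Ideal.span {C₀} →
          FibrePinned G (toUnr₂ 2 J C₀)

/-- **ACPIN on the habitat (β)** (v7 / seat 1, verbatim = the registered `stub_acFibrePinning`'s statement). -/
def AcFibrePinningAtTwo : Prop :=
  ∀ (W : WeierstrassCurve ℚ) [W.IsElliptic] [W.IsGloballyMinimal],
    ¬ W.HasCM → GoodOrd W 2 → ¬ W.HasIrreducibleModPGaloisRep 2 →
    ∀ (K : Type) [Field K] [NumberField K],
      (IsImaginaryQuadratic K ∧ SatisfiesHeegnerHypothesis (2 * W.conductorNorm ℤ) K) →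
      GreenbergAcFibrePinningAt W K

/-- **L1 (KERNEL leaf, ATTACKABLE): the residual line functional of a PRIMITIVE covector is onto** (`a` a unit ⟹
`red((1+T)^a − 1) = T + …` has order one ⟹ `𝔽̄₂⟦T₁,T₂⟧ → 𝔽̄₂⟦T⟧` hits `T·(unit)`, hence everything; symmetric in `b`). -/
def RedLineSurjective₂ : Prop :=
  ∀ (J : ℤ_[2] →+* PadicComplexInt 2) (a b : ℤ_[2]), IsUnit a ∨ IsUnit b → Function.Surjective (redLineRes J a b)

/-- **KERNEL (proved): a line reading in `∣`-currency through an ONTO residual functional `φ` pins the fibre at `𝔓 := ker φ`**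
(prime since `𝔽̄₂⟦T⟧` is a domain; the quotient lifts along `φ`).  v7's `fibrePinned_of_lineReading` in `∣`-currency. -/
theorem fibrePinned_of_redLine {φ : Ω₂ →+* Ω₁} (hφ : Function.Surjective φ) {G C' : A₂} (hN : φ (red₂ G) ≠ 0)
    (hΛ : ∀ (a : ℕ) (C₁ : A₂), C' = (2 : A₂) ^ a * C₁ → red₂ C₁ ≠ 0 → φ (red₂ G) ∣ φ (red₂ C₁)) :
    FibrePinned G C' := by
  refine ⟨RingHom.ker φ, RingHom.ker_isPrime φ, fun h => hN ((RingHom.mem_ker).mp h), fun a C₁ hC₁ hred => ?_⟩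
  obtain ⟨q, hq⟩ := hΛ a C₁ hC₁ hred
  obtain ⟨q', rfl⟩ := hφ q
  have hk : red₂ C₁ - q' * red₂ G ∈ RingHom.ker φ := by
    rw [RingHom.mem_ker, map_sub, map_mul, hq]
    ring
  have hsplit : red₂ C₁ = (red₂ C₁ - q' * red₂ G) + q' * red₂ G := by ring
  rw [hsplit]
  exact Ideal.add_mem _ (Ideal.mem_sup_left hk) (Ideal.mem_sup_right (Ideal.mem_span_singleton'.mpr ⟨q', rfl⟩))

/-- **SEAM to the line of record (KERNEL, proved modulo the kernel leaf L1): N_cyc ∧ Λ_cyc ∧ L1 ⟹ ACPIN** — v7's registered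
`stub_acFibrePinning` statement, with `𝔓 := 𝔓_cyc = ker (redLineRes J (κγ₁) (κγ₂))` the residual prime of the CYCLOTOMIC line
(the consumer's prime). -/
theorem acFibrePinningAtTwo_of_cycLine (hL1 : RedLineSurjective₂) :
    CycLineMuZeroAtTwo → CycLineLambdaAtTwo → AcFibrePinningAtTwo := by
  intro hN hΛ W _ _ hCM hGO hβ K _ _ hK _ ι v vbar κ₁ κ₂ γ₁ γ₂ _ _ f hf _ hv hvbar hne hι Ω δ Ωp LK G hΩ hδ hLK hG J hJ C₀ hC
  obtain ⟨κ, hκ⟩ := ZpExtension.exists_isCyclotomic_holds K 2 (GaloisRep.cyclotomicCharacter_range_infinite K 2)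
  have hprim := isUnit_or_isUnit_of_line hK.1.1.le
    (Fact.out : ZpExtension.IsTopGeneratorPair κ₁ κ₂ γ₁ γ₂) κ
  refine fibrePinned_of_redLine (hL1 J _ _ hprim) ?_ ?_
  · rw [redLineRes_red₂]
    exact hN W hCM hGO hβ K hK ι v vbar κ₁ κ₂ γ₁ γ₂ f hf hv hvbar hne hι Ω δ Ωp LK G hΩ hδ hLK hG J hJ κ hκ
  · intro a C₁ hC₁ hred
    rw [redLineRes_red₂, redLineRes_red₂]
    exact hΛ W hCM hGO hβ K hK ι v vbar κ₁ κ₂ γ₁ γ₂ f hf hv hvbar hne hι Ω δ Ωp LK G hΩ hδ hLK hG J hJ C₀ hC a C₁ hC₁ hred κ hκ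

/-! ### §5c The deep-point residual lemma (KERNEL leaf DP, typed; one variable) -/

/-- **DP — `DeepPointResidual₁` (KERNEL, ATTACKABLE; elementary ultrametric dominance).**  For `D ∈ 𝒪_{ℂ₂}⟦T⟧` and points
`z_i ∈ 𝔪_{ℂ₂}` with `‖z_i‖ → 1`: if the values `D(z_i)` stay in a ball `‖·‖ ≤ c < 1`, then `red D = 0`.  (If `red D ≠ 0`
with order `n₀`, then `‖D(z)‖ = ‖z‖^{n₀}` as soon as `‖z‖^{n₀} > max_{n<n₀} ‖d_n‖`; so `‖D(z_i)‖ → 1`.)  Consequence used by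
the node: if `G|_ℓ − u·M|_ℓ` is `2`-adically small at a deep sequence then `red(G|_ℓ) = red(u)·red(M|_ℓ)`, so `μ` and `λ` of
`G|_ℓ` are those of the Eisenstein model `M|_ℓ` — read from PRINT.  Values are series sums in `ℂ₂`; no evaluation API assumed. -/
def DeepPointResidual₁ : Prop :=
  ∀ (D : A₁) (z : ℕ → PadicComplexInt 2) (y : ℕ → ℂ_[2]) (c : ℝ), c < 1 →
    (∀ i, ‖((z i : PadicComplexInt 2) : ℂ_[2])‖ < 1) →
    Filter.Tendsto (fun i => ‖((z i : PadicComplexInt 2) : ℂ_[2])‖) Filter.atTop (nhds 1) →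
    (∀ i, HasSum (fun n : ℕ => ((PowerSeries.coeff n D : PadicComplexInt 2) : ℂ_[2]) *
      ((z i : PadicComplexInt 2) : ℂ_[2]) ^ n) (y i)) →
    (∀ i, ‖y i‖ ≤ c) → red₁ D = 0

/-- DP, degenerate direction (sanity, KERNEL, proved): the zero series has all deep values `0`. -/
theorem deepPointResidual₁_zero_hasSum (z : PadicComplexInt 2) :
    HasSum (fun n : ℕ => ((PowerSeries.coeff n (0 : A₁) : PadicComplexInt 2) : ℂ_[2]) *
      ((z : PadicComplexInt 2) : ℂ_[2]) ^ n) 0 := by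
  simp

/-! ## §6 Stubs of THIS node (NOT registered — the slot of record is v7/v8 `two_variable_gv_squeeze_two`) and the composition BY NAME -/

/-- **stub P0** (KERNEL, proved — p766476 — by name). -/
theorem stub_charIdealPrincipal : XGr₂CharIdealPrincipalAtTwo :=
  fun W _ _ K _ _ vbar κ₁ κ₂ γ₁ γ₂ _ h =>
    Summit.BirchSwinnertonDyer.BirchSwinnertonDyer.Theorems.TwoAdicBDPCharIdealPrincipal.exists_xGr₂_charIdeal_eq_span_two
      W K vbar κ₁ κ₂ γ₁ γ₂ h

/-- **stub CONTENT** (KERNEL, proved in §0). -/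
theorem stub_twoContent : TwoContent₂ := twoContent₂_holds

/-- **stub U** (research, SHARED statement with v7's registered `stub_upperInclusionRat`; used by architecture (i) ONLY). -/
theorem stub_upperInclusionRat : TwoVariableUpperInclusionRatAtTwo := by
  sorry

/-- **stub R0T** (SHARED statement `TwoVariableFrameTorsionAtTwo`; v7 DERIVES it: PRINT `thmII417` ∧ R0G ∧ P3 ∧ P4 ∧ P5). -/
theorem stub_frameTorsion : TwoVariableFrameTorsionAtTwo := by
  sorry

/-- **stub N_cyc** (research ∧ PRINT: RIP ∧ VC ∧ DP ∧ N^{Katz}_cyc): `μ` of the cyclotomic shadow of `G` is `0` in every frame. -/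
theorem stub_cycLineMuZero : CycLineMuZeroAtTwo := by
  sorry

/-- **stub Λ_cyc** (research ∧ PRINT ∧ kernel: RIP ∧ VC ∧ DP ∧ N^{Katz}_cyc ∧ ALG_cyc): `red(G|_cyc) ∣ red(C₁|_cyc)` in every frame. -/
theorem stub_cycLineLambda : CycLineLambdaAtTwo := by
  sorry

/-- **Composition BY NAME** (architecture (i)): the crux `BDPSelmerLowerDivisibilityAtTwo` from `stub_charIdealPrincipal` (P0, kernel),
`stub_twoContent` (CONTENT, kernel), `stub_upperInclusionRat` (U), `stub_frameTorsion` (R0T), `stub_cycLineMuZero` (N_cyc),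
`stub_cycLineLambda` (Λ_cyc).  Sorries = exactly {U, R0T, N_cyc, Λ_cyc}. -/
theorem BDPSelmerLowerDivisibilityAtTwo_of_cycLine : BDPSelmerLowerDivisibilityAtTwo :=
  bdpSelmerLowerDivisibilityAtTwo_of_cycLine stub_charIdealPrincipal stub_twoContent stub_upperInclusionRat
    stub_frameTorsion stub_cycLineMuZero stub_cycLineLambda

/-! ## §7 (GEN 9, new) ARCHITECTURE (ii): the SAME leaves deliver seat 1's U-free cyclotomic shadow O2′ and the consumer 6‴

Seat 1 GEN 7 (`Lines/cyclotomic_shadow_two.lean`, namespace `…CyclotomicShadowTwo`) decls re-declared VERBATIM: `line₁`, `shadow`,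
`GreenbergCycNondegAt`/`CycNondegAtTwo` (N_alg: `μ` of the cyclotomic shadow of `ch(X_Gr₂)` vanishes — their ATTACKABLE GL(1)-grade
piece), `GreenbergCycShadowAt`/`CycShadowLowerAtTwo` (O2′), `SplitTwoERLCycShadow` (O1′) and their consumer seam
`thetaShapiroGreenbergDivisibilityAtTwo_of_cycShadow` (O1′ ∧ O2′ ⟹ 6‴).  NEW: the kernel leaf L2 (the cyclotomic covector of a
cyclotomically adapted frame is `(1, 0)` and its reading is `shadow`) and the seams `cycShadowLowerAtTwo_of_cycLine`,
`thetaShapiroGreenbergDivisibilityAtTwo_of_cycLine` — sorry-free given the pieces. -/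

/-- Restriction of a residual series to the `κ₁`-line: kill the INNER variable (`T₂ = 0`). [seat 1 GEN 7, verbatim] -/
def line₁ : Ω₂ →+* Ω₁ :=
  PowerSeries.map (PowerSeries.constantCoeff (R := IsLocalRing.ResidueField (PadicComplexInt 2)))

/-- **The cyclotomic shadow** `sh : 𝒪_{ℂ₂}⟦T₁,T₂⟧ → 𝔽̄₂⟦T₁⟧`: reduce, then restrict to the `κ₁`-line. [seat 1 GEN 7, verbatim] -/
def shadow : A₂ →+* Ω₁ := line₁.comp red₂

theorem shadow_apply (F : A₂) : shadow F = line₁ (red₂ F) := rfl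

/-- **N_alg at `(E,K)`** [= seat 1's `GreenbergCycNondegAt`, verbatim]: at cyclotomically adapted frames, the cyclotomic shadow of
(every generator of) `ch(X_Gr₂)` is non-zero. -/
def GreenbergCycNondegAt (W : WeierstrassCurve ℚ) [W.IsElliptic] [W.IsGloballyMinimal]
    (K : Type) [Field K] [NumberField K] : Prop :=
  ∀ (vbar : HeightOneSpectrum (𝓞 K)) (κ₁ κ₂ : ZpExtension K 2) (γ₁ γ₂ : absoluteGaloisGroup K)
    [Fact (ZpExtension.IsTopGeneratorPair κ₁ κ₂ γ₁ γ₂)],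
    κ₁.IsCyclotomic → ((2 : ℕ) : 𝓞 K) ∈ vbar.asIdeal →
    ∀ (J : ℤ_[2] →+* PadicComplexInt 2) (C : IwasawaAlgebra₂ 2),
      WeierstrassCurve.XGr₂.charIdeal (W.baseChange K) 2 κ₁ κ₂ vbar γ₁ γ₂ = Ideal.span {C} →
      shadow (toUnr₂ 2 J C) ≠ 0

/-- **O2′ at `(E,K)`** [= seat 1's `GreenbergCycShadowAt`, verbatim]: the cyclotomic `λ`-shadow of O2. -/
def GreenbergCycShadowAt (W : WeierstrassCurve ℚ) [W.IsElliptic] [W.IsGloballyMinimal]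
    (K : Type) [Field K] [NumberField K] : Prop :=
  ∀ [IsCMField K] (ι : PadicAlgCl 2 ≃+* ℂ) (v vbar : HeightOneSpectrum (𝓞 K)) (κ₁ κ₂ : ZpExtension K 2)
    (γ₁ γ₂ : absoluteGaloisGroup K) [Fact (ZpExtension.IsTopGeneratorPair κ₁ κ₂ γ₁ γ₂)]
    [NeZero (W.conductorNorm ℤ)] (f : CuspForm (Gamma0 (W.conductorNorm ℤ)) 2),
    ModularForms.IsNewformOf W f → ∀ [NeZero (NumberField.discr K).natAbs],
    ((2 : ℕ) : 𝓞 K) ∈ v.asIdeal → ((2 : ℕ) : 𝓞 K) ∈ vbar.asIdeal → vbar ≠ v →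
    (∀ (w : InfinitePlace K) (k : 𝓞 K), k ∈ v.asIdeal ↔ ‖ι.symm (w.embedding (k : K))‖ < 1) →
    κ₁.IsCyclotomic →
    ∃ (Ω δ : ℂ) (Ωp : (unrIntegers 2)ˣ) (LK G : A₂),
      Ω ≠ 0 ∧ (δ ^ 2 = (NumberField.discr K : ℂ) ∨ δ ^ 2 = -(NumberField.discr K : ℂ)) ∧
      IsKatzMeasure₂ ι v vbar ∅ κ₁ κ₂ γ₁⁻¹ γ₂⁻¹ 1 Ω δ ((Ωp : unrIntegers 2) : ℂ_[2]) LK ∧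
      IsGreenbergLFunctionFree₂ ι v vbar κ₁ κ₂ γ₁⁻¹ γ₂⁻¹ f (NumberField.discr K).natAbs
        (NumberField.classNumber K) LK G ∧
      Module.IsTorsion (IwasawaAlgebra₂ 2) ((W.baseChange K).XGr₂ 2 κ₁ κ₂ vbar γ₁ γ₂) ∧
      ∀ J : ℤ_[2] →+* PadicComplexInt 2,
        (∀ x : ℤ_[2], ((J x : PadicComplexInt 2) : ℂ_[2]) = ((x : ℚ_[2]) : ℂ_[2])) →
        ∀ C : IwasawaAlgebra₂ 2,
          WeierstrassCurve.XGr₂.charIdeal (W.baseChange K) 2 κ₁ κ₂ vbar γ₁ γ₂ = Ideal.span {C} →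
          shadow (toUnr₂ 2 J C) ≠ 0 ∧ shadow G ≠ 0 ∧ (shadow G).order ≤ (shadow (toUnr₂ 2 J C)).order

/-- O2′ on the habitat of O2 [= seat 1's `CycShadowLowerAtTwo`, verbatim]. -/
def CycShadowLowerAtTwo : Prop :=
  ∀ (W : WeierstrassCurve ℚ) [W.IsElliptic] [W.IsGloballyMinimal],
    ¬ W.HasCM → GoodOrd W 2 → ¬ W.HasIrreducibleModPGaloisRep 2 →
    ∀ (K : Type) [Field K] [NumberField K],
      (IsImaginaryQuadratic K ∧ SatisfiesHeegnerHypothesis (2 * W.conductorNorm ℤ) K) →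
      GreenbergCycShadowAt W K

/-- N_alg on the habitat of O2 [= seat 1's `CycNondegAtTwo`, verbatim]. -/
def CycNondegAtTwo : Prop :=
  ∀ (W : WeierstrassCurve ℚ) [W.IsElliptic] [W.IsGloballyMinimal],
    ¬ W.HasCM → GoodOrd W 2 → ¬ W.HasIrreducibleModPGaloisRep 2 →
    ∀ (K : Type) [Field K] [NumberField K],
      (IsImaginaryQuadratic K ∧ SatisfiesHeegnerHypothesis (2 * W.conductorNorm ℤ) K) →
      GreenbergCycNondegAt W K

/-- **O1′** [= seat 1's `SplitTwoERLCycShadow`, verbatim]: the cyclotomic `λ`-shadow of the Greenberg side ⟹ 6‴ at `(E,K)`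
(O1 = item 24727 read in `λ`-currency; research, unchanged status). -/
def SplitTwoERLCycShadow : Prop :=
  ∀ (W : WeierstrassCurve ℚ) [W.IsElliptic] [W.IsGloballyMinimal],
    ¬ W.HasCM → GoodOrd W 2 → ¬ W.HasIrreducibleModPGaloisRep 2 →
    ∀ (K : Type) [Field K] [NumberField K],
      (IsImaginaryQuadratic K ∧ SatisfiesHeegnerHypothesis (2 * W.conductorNorm ℤ) K) →
      GreenbergCycShadowAt W K → ThetaDivisibilityAt W K

/-- **Seat 1's consumer seam: O1′ ∧ O2′ ⟹ 6‴** [= `CyclotomicShadowTwo.thetaShapiroGreenbergDivisibilityAtTwo_of_cycShadow`,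
verbatim]. [folklore] -/
theorem thetaShapiroGreenbergDivisibilityAtTwo_of_cycShadow (h₁ : SplitTwoERLCycShadow)
    (h₂ : CycShadowLowerAtTwo) : ThetaShapiroGreenbergDivisibilityAtTwo := by
  intro W _ _ hCM hGO hβ κ γ hκ hγ hγ' hord _ f hf D L₀ hL₀ K _ _ hK
  exact h₁ W hCM hGO hβ K hK (h₂ W hCM hGO hβ K hK) κ γ hκ hγ hγ' hord f hf D L₀ hL₀

/-- **L2 (KERNEL leaf, ATTACKABLE): the cyclotomic reading in a cyclotomically ADAPTED frame is seat 1's `shadow`.**  The covector of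
`κ₁` in its own frame is `(κ₁γ₁, κ₁γ₂) = (1, 0)` (`IsTopGenerator`, `kerSubgroup`), and the line functional of covector `(1, 0)`
substitutes `T₁ ↦ red((1+T)^1 − 1) = T`, `T₂ ↦ red((1+T)^0 − 1) = 0`, i.e. kills the inner variable: `red₁ ∘ lineRes J 1 0 = line₁ ∘ red₂`
(`binomialSeries` at `1` and `0` + `redLineRes_red₂` + one substitution computation). -/
def CycCovectorReading₂ : Prop :=
  ∀ (J : ℤ_[2] →+* PadicComplexInt 2) (x : A₂), red₁ (lineRes J 1 0 x) = shadow x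

/-- In a presented pair, the covector of `κ₁` is `(1, 0)`. (kernel, proved) -/
theorem toAdd_apply_left_eq_one {K : Type} [Field K] [NumberField K] {κ₁ κ₂ : ZpExtension K 2}
    {γ₁ γ₂ : absoluteGaloisGroup K} (h : ZpExtension.IsTopGeneratorPair κ₁ κ₂ γ₁ γ₂) :
    Multiplicative.toAdd (κ₁ γ₁) = 1 := by
  have h1 : κ₁ γ₁ = Multiplicative.ofAdd 1 := h.1
  rw [h1, toAdd_ofAdd]

theorem toAdd_apply_right_eq_zero {K : Type} [Field K] [NumberField K] {κ₁ κ₂ : ZpExtension K 2}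
    {γ₁ γ₂ : absoluteGaloisGroup K} (h : ZpExtension.IsTopGeneratorPair κ₁ κ₂ γ₁ γ₂) :
    Multiplicative.toAdd (κ₁ γ₂) = 0 := by
  have h1 : κ₁ γ₂ = 1 := ZpExtension.mem_kerSubgroup.mp h.2.2.1
  rw [h1, toAdd_one]

/-- `x ∣ y`, `y ≠ 0`-free: divisibility bounds the `T`-order from below in `𝔽̄₂⟦T⟧`. (kernel, proved) -/
theorem order_le_of_dvd {x y : Ω₁} (h : x ∣ y) : x.order ≤ y.order := by
  obtain ⟨q, rfl⟩ := h
  exact le_trans le_self_add (PowerSeries.le_order_mul _ _)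

/-- `shadow F ≠ 0 → red₂ F ≠ 0`. (kernel, proved) -/
theorem red₂_ne_zero_of_shadow_ne_zero {F : A₂} (h : shadow F ≠ 0) : red₂ F ≠ 0 := by
  intro h0
  apply h
  rw [shadow_apply, h0, map_zero]

section SeamsII

variable (W : WeierstrassCurve ℚ) [W.IsElliptic] [W.IsGloballyMinimal] (K : Type) [Field K] [NumberField K]

/-- **T — R0T ∧ N_alg ∧ N_cyc ∧ Λ_cyc ∧ L2 ⟹ O2′ at `(E,K)`** (sorry-free): in a cyclotomically adapted frame take `κ := κ₁` in N_cyc /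
Λ_cyc (covector `(1, 0)`), the primitive part `C₁ := C^J` itself (`a = 0`; `red C^J ≠ 0` from N_alg), and read through L2.  NO upper
inclusion, NO residual divisor equality, NO Gauss rigidity, NO frame normalisation. -/
theorem cycShadowAt_of_cycLine (hL2 : CycCovectorReading₂) (hR0 : GreenbergFrameTorsionAt W K)
    (hNa : GreenbergCycNondegAt W K) (hN : GreenbergCycLineMuZeroForallAt W K) (hΛ : GreenbergCycLineLambdaForallAt W K) :
    GreenbergCycShadowAt W K := by
  intro _ ι v vbar κ₁ κ₂ γ₁ γ₂ hpair _ f hf _ hv hvbar hne hemb hcyc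
  obtain ⟨Ω, δ, Ωp, LK, G, hΩ, hδ, hLK, hG, htor⟩ := hR0 ι v vbar κ₁ κ₂ γ₁ γ₂ f hf hv hvbar hne hemb
  refine ⟨Ω, δ, Ωp, LK, G, hΩ, hδ, hLK, hG, htor, fun J hJ C hC => ?_⟩
  have hNC : shadow (toUnr₂ 2 J C) ≠ 0 := hNa vbar κ₁ κ₂ γ₁ γ₂ hcyc hvbar J C hC
  have hred : red₂ (toUnr₂ 2 J C) ≠ 0 := red₂_ne_zero_of_shadow_ne_zero hNC
  have hsplit : toUnr₂ 2 J C = (2 : A₂) ^ 0 * toUnr₂ 2 J C := by rw [pow_zero, one_mul]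
  have h1 := toAdd_apply_left_eq_one hpair.out
  have h2 := toAdd_apply_right_eq_zero hpair.out
  have hN' := hN ι v vbar κ₁ κ₂ γ₁ γ₂ f hf hv hvbar hne hemb Ω δ Ωp LK G hΩ hδ hLK hG J hJ κ₁ hcyc
  have hΛ' := hΛ ι v vbar κ₁ κ₂ γ₁ γ₂ f hf hv hvbar hne hemb Ω δ Ωp LK G hΩ hδ hLK hG J hJ C hC 0 (toUnr₂ 2 J C) hsplit hred
    κ₁ hcyc
  rw [h1, h2, hL2] at hN'
  rw [h1, h2, hL2, hL2] at hΛ'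
  exact ⟨hNC, hN', order_le_of_dvd hΛ'⟩

end SeamsII

/-- **R0T ∧ N_alg ∧ N_cyc ∧ Λ_cyc ∧ L2 ⟹ O2′ on the habitat** — architecture (ii), the U-FREE node, sorry-free given the pieces. -/
theorem cycShadowLowerAtTwo_of_cycLine (hL2 : CycCovectorReading₂) (hR0 : TwoVariableFrameTorsionAtTwo) (hNa : CycNondegAtTwo)
    (hN : CycLineMuZeroAtTwo) (hΛ : CycLineLambdaAtTwo) : CycShadowLowerAtTwo := by
  intro W _ _ hCM hGO hβ K _ _ hK
  exact cycShadowAt_of_cycLine W K hL2 (hR0 W hCM hGO hβ K hK) (hNa W hCM hGO hβ K hK) (hN W hCM hGO hβ K hK)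
    (hΛ W hCM hGO hβ K hK)

/-- **6‴ WITHOUT U: O1′ ∧ R0T ∧ N_alg ∧ N_cyc ∧ Λ_cyc ∧ L2 ⟹ `ThetaShapiroGreenbergDivisibilityAtTwo`** (the unique consumer of
O1 ∧ O2), sorry-free given the pieces — the same research leaves N_cyc, Λ_cyc as architecture (i), and neither U nor Rres. -/
theorem thetaShapiroGreenbergDivisibilityAtTwo_of_cycLine (h₁ : SplitTwoERLCycShadow) (hL2 : CycCovectorReading₂)
    (hR0 : TwoVariableFrameTorsionAtTwo) (hNa : CycNondegAtTwo) (hN : CycLineMuZeroAtTwo) (hΛ : CycLineLambdaAtTwo) :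
    ThetaShapiroGreenbergDivisibilityAtTwo :=
  thetaShapiroGreenbergDivisibilityAtTwo_of_cycShadow h₁ (cycShadowLowerAtTwo_of_cycLine hL2 hR0 hNa hN hΛ)

/-- **O2 ∧ N_alg ⟹ O2′** [seat 1's T1, re-proved here for cost transparency]: architecture (i)'s output implies architecture (ii)'s —
the two targets of the node are nested, not rival. -/
theorem cycShadowLowerAtTwo_of_bdp (hO2 : BDPSelmerLowerDivisibilityAtTwo) (hNa : CycNondegAtTwo) : CycShadowLowerAtTwo := by
  intro W _ _ hCM hGO hβ K _ _ hK _ ι v vbar κ₁ κ₂ γ₁ γ₂ _ _ f hf _ hv hvbar hne hemb hcyc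
  obtain ⟨Ω, δ, Ωp, LK, G, hΩ, hδ, hLK, hG, htor, hdiv⟩ := hO2 W hCM hGO hβ K hK ι v vbar κ₁ κ₂ γ₁ γ₂ f hf hv hvbar hne hemb
  refine ⟨Ω, δ, Ωp, LK, G, hΩ, hδ, hLK, hG, htor, fun J hJ C hC => ?_⟩
  have hNC : shadow (toUnr₂ 2 J C) ≠ 0 := hNa W hCM hGO hβ K hK vbar κ₁ κ₂ γ₁ γ₂ hcyc hvbar J C hC
  have hle : Ideal.span {toUnr₂ 2 J C} ≤ Ideal.span {G} := by
    have h := hdiv J hJ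
    rw [hC, Ideal.map_span, Set.image_singleton] at h
    exact h
  have hmem : toUnr₂ 2 J C ∈ Ideal.span {G} := hle (Ideal.mem_span_singleton_self _)
  obtain ⟨q, hq⟩ := Ideal.mem_span_singleton'.mp hmem
  have hsx : shadow (toUnr₂ 2 J C) = shadow q * shadow G := by rw [← hq, map_mul]
  refine ⟨hNC, ?_, ?_⟩
  · intro hg
    apply hNC
    rw [hsx, hg, mul_zero]
  · rw [hsx]
    exact le_trans le_add_self (PowerSeries.le_order_mul _ _)

end Summit.BirchSwinnertonDyer.BirchSwinnertonDyer.Cruxes.BDPSelmerLowerDivisibilityAtTwo.CyclotomicPrimePinningTwo
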